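import Literature.Geometry.Kaehler.ComplexTorusAbelianFivefoldEllipticFactorConditionD
import Literature.Geometry.Kaehler.ComplexTorusSimpleAbelianThreefoldTimesSurfaceConditionD
import Literature.Geometry.Kaehler.ComplexTorusSimpleCMSurfaceHodgeGroupAlmostQSimple
import Literature.Geometry.Kaehler.ComplexTorusAbelianThreefoldImaginaryQuadraticTimesSurfaceConditionD
import Literature.Geometry.Kaehler.ComplexTorusSimpleCMThreefoldTimesCMSurfaceHodgeGroup
import HarnessLib

/-!
# Moonen–Zarhin 1999 Thm. (0.2) (4), «if `X` has no simple factor of dimension 4 then `Hg(X) = Sp_D(V,φ)` and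
# `ℬ•(Xⁿ) = 𝒟•(Xⁿ)`», for NON-SIMPLE complex abelian FIVEFOLDS, decomposition-free: a polarised fivefold which is not simple,
# has no simple abelian fourfold as an isogeny factor and is not in the cases (e), (f) satisfies condition (D) and has
# `Hg(X) = Sp_D(V,φ)` — the assembly of the seat's dimension-5 rows along the Poincaré split of `X`

Layer `Literature/Geometry/Kaehler`, namespace `Literature.Geometry.Kaehler.ComplexTorus`; lane `lit-hodgefound` (Track 2
foundations library), Layer A4 (known cases of `ℬ = 𝒟`); prover seat `lit-hodgefound-p17`, generation 55, self-proposed row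
g55-#4 — the DECOMPOSITION-FREE STATEMENT assembling ✔ g55-#1 `ComplexTorusAbelianFivefoldSurfaceFactorsConditionD` (all simple
factors of dimension `≤ 2`), ✔ g55-#2 `ComplexTorusAbelianFivefoldEllipticFactorConditionD` (`X ∼ Y × E`, `Y` a non-simple
fourfold) and g55-#3 `ComplexTorusSimpleAbelianThreefoldTimesSurfaceConditionD` (`X ∼ T × S`).  THEOREMS ONLY (no definition, no
instance, no notation, no named fact; D-0026 net debt `0`).

## Source, VERBATIM (held `paper:arxiv-math_9901113`; locators are page ∕ line of the materialisation)

B. J. J. Moonen, Yu. G. Zarhin [MoonenZarhin1999LowDim], *Hodge classes on abelian varieties of low dimension*, Math. Ann.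
**315** (1999) 711–733, Thm. (0.2) (p0001 L144 – p0002 L8): «Let `X` be a complex abelian variety of dimension 5. Let `V`, `φ`,
`D` and `Sp_D(V,φ)` have the same meaning as in (0.1). … (4) Suppose we are not in one of the cases (e), (f) or (g). Decompose
`X`, up to isogeny, as a product of elementary abelian varieties, say `X ∼ Y₁^{m₁} × ⋯ × Y_r^{m_r}`. Then `Hg(X) = Hg(Y₁^{m₁}) ×
⋯ Hg(Y_r^{m_r})`. For every `n ≥ 1` the Hodge ring `ℬ•(Xⁿ)` is generated by the images of the Hodge rings `ℬ•(Y_j^{m_j})`. In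
particular, if `X` has no simple factor of dimension 4 then `Hg(X) = Sp_D(V,φ)` and `ℬ•(Xⁿ) = 𝒟•(Xⁿ)` for every `n ≥ 1`.»  The
cases (p0001 L77–L80, L127–L140): «(a) The abelian variety `X` is isogenous to a product `X₁ × X₂` where `X₁` is an elliptic
curve with complex multiplication by an imaginary quadratic field `k` and where `X₂` is a simple abelian threefold such that
there exists an embedding `k ↪ End⁰(X₂)`. … (e) The abelian variety `X` is isogenous to a product `X₁² × X₂`, where `X₁` and `X₂`
are as in (a). (f) The abelian variety `X` is isogenous to a product `X₀ × X₁ × X₂`, where `X₀` is an elliptic curve, where `X₁`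
and `X₂` are as in (a), and such that `X₀` and `X₁` are not isogenous. (g) The abelian variety `X` is isogenous to a product
`X₁ × X₂` where `X₁` is an elliptic curve … and where `X₂` is a simple abelian fourfold …».  Proof §5 (p0009 L110 – p0011 L12):
«the statement is known if `X` is simple. So again we may, and shall, assume `X` to be non-simple. … Write `X₁ ⊆ X` for the
maximal abelian subvariety which has no factors of Type 4, and `X₂ ⊆ X` for the maximal abelian subvariety of which all factors
are of Type 4. Write `d_i = dim(X_i)`. We shall treat the possibilities case by case.» — (5.6) `(5,0)`, (5.7) `(4,1)` ∕ `(3,2)`,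
(5.8) `(2,3)`, (5.9) `(1,4)`, (5.10) `(0,5)` with `d_min = 2`, (5.11) `(0,5)` with `d_min = 1`, (5.12) the Hodge rings.

* H. Lange [Lange2023AbelianVarietiesComplex], *Abelian Varieties over the Complex Numbers* (2023), §2.4.4 Thm. 2.4.25 (Poincaré's
  complete reducibility), Cor. 2.4.26, §1.1.2 Cor. 1.1.16, §1.1.6 Exercise (1)(a) (a one-dimensional complex torus is an `E_τ`).
* H. P. F. Swinnerton-Dyer [SwinnertonDyer1974AbelianVarieties], *Analytic theory of abelian varieties*, Ch. II §7 Cor. 3.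
* B. B. Gordon [Gordon1999HodgeAVSurvey], *A survey of the Hodge conjecture for abelian varieties*, Thm. 7.5 (1) ⟺ (2).
* J. S. Milne [Milne1999LefschetzClasses], Duke Math. J. **96** (1999), §4 Prop. 4.8.

## The hypotheses (Moonen–Zarhin's exclusions, read on isogeny decompositions of `X`) and what is NOT covered

* `h4` — «no simple factor of dimension 4»: `X` is not isogenous to `Y × E_τ` with `Y` a simple polarised abelian fourfold
  (for `dim X = 5` a simple factor of dimension `4` has an elliptic complementary factor).  This also excludes case (g).
* `hef` — «not (e), not (f)»: whenever `X ∼ (T × E_σ) × E_ρ` with `T` a simple polarised threefold and `E_ρ` with complex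
  multiplication by `k = ℚ(ρ)`, there is no embedding `k = ℚ[ρ] ↪ End⁰(T)` ((e) is `E_σ ∼ E_ρ`, (f) is `E_σ ≁ E_ρ`).
* `hTS` — THE RESIDUAL HYPOTHESIS of g55-#3 (-- TODO(general form): Moonen–Zarhin prove these sub-cases too, (5.8) via Lemma
  (3.5) and (5.10) via Lemma (3.6)–(3.7) and a Galois-group argument; they are not yet in the tree): whenever `X ∼ T × S` with
  `T` a simple polarised threefold whose endomorphism algebra has a CM field as centre (types IV(1,1), IV(3,1)) and `S` a simple
  polarised surface, then `End⁰(S) = ℚ`, or `T` is of CM type and `S` is not.  Under `hTS` the shapes `T` of type IV(1,1) × `S`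
  of type I(2) ∕ II(1) ∕ IV and `T` CM × `S` CM do not occur.

## The assembly

Poincaré (the tree's `IsRiemannForm.exists_isIsogenous_prod_of_not_isSimple`): `X ∼ A × B` with `A = π(V)`, `B = π(V^⊥)` polarised
Poincaré subtori, `dim A + dim B = 5`.  `(4,1)` ∕ `(1,4)`: `B ≅ E_τ` (resp. `A`); the fourfold is not simple by `h4`, and ✔ g55-#2
applies.  `(3,2)` ∕ `(2,3)`: `T × S`; `S` non-simple ⟹ `S ∼ E_a × E_b`, `X ∼ (T × E_a) × E_b` (✔ g55-#2, with `hef`); `S` simple, `T`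
non-simple ⟹ `T ∼ S' × E_c`, `X ∼ (S' × S) × E_c` (✔ g55-#1); both simple ⟹ g55-#3 with `hTS`.  `Hg(X) = Sp_D(V,φ)` by Gordon's
Thm. 7.5 (A4-103).

## What is proved

* §1 the two ordered shapes: **`IsIsogenous.forall_divisorClasses_powPeriod_eq_hodgeClasses_of_prod_of_finrank_eq_four_one`**
  (`X ∼ A × C`, `dim A = 4`, `dim C = 1`), **`IsIsogenous.forall_divisorClasses_powPeriod_eq_hodgeClasses_of_prod_of_finrank_eq_three_two_of_forall`**
  (`X ∼ T × S`, `dim T = 3`, `dim S = 2`, `T`, `S` polarised, simple or not).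
* §2 **`IsRiemannForm.forall_divisorClasses_powPeriod_eq_hodgeClasses_of_not_isSimple_of_finrank_eq_five`** (THE DIMENSION-5
  THEOREM, hypotheses `h4`, `hef`, `hTS`), **`IsRiemannForm.hodgeGroup_eq_lefschetzGroup_of_not_isSimple_of_finrank_eq_five`**
  («`Hg(X) = Sp_D(V,φ)`», real points), `IsAbelianVariety.forall_divisorClasses_powPeriod_eq_hodgeClasses_of_not_isSimple_of_finrank_eq_five`
  and the isogeny form `IsIsogenous.forall_divisorClasses_powPeriod_eq_hodgeClasses_of_not_isSimple_of_finrank_eq_five`.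
* §3 (g55-#6, appended) THE SMALLER RESIDUAL after g55-#5 `ComplexTorusSimpleCMSurfaceHodgeGroupAlmostQSimple` («the torus `U_F`
  is `ℚ`-simple» ⟹ `T` of type IV(1,1) × `S` CM splits, (5.10) with `Y₂` not of CM type): the shape `(3,2)` and the
  dimension-5 theorem with `hTS` weakened to `hTS'` — whenever `X ∼ T × S` (both simple, centre of `End⁰(T)` a CM field):
  `End⁰(S) = ℚ`, or `T` CM and `S` not, OR `[Z(End⁰ T) : ℚ] = 2` AND `S` CM —
  **`IsRiemannForm.forall_divisorClasses_powPeriod_eq_hodgeClasses_of_not_isSimple_of_finrank_eq_five_of_isCMField_imp`**,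
  **`IsRiemannForm.hodgeGroup_eq_lefschetzGroup_of_not_isSimple_of_finrank_eq_five_of_isCMField_imp`**, the `IsAbelianVariety.`
  and isogeny forms.  What is still NOT covered (-- TODO(general form)): `X ∼ T × S` with `T` of type IV(1,1) and `S` of
  type I(2) ∕ II(1) ((5.8), Lemma (3.5)), and with `T`, `S` both of CM type ((5.10), the Galois-group comparison).
* §4 (g55-#9, appended) THE LAST RESIDUAL after g55-#8 `ComplexTorusAbelianThreefoldImaginaryQuadraticTimesSurfaceConditionD`
  ((5.8) with `X₁` simple: `T` of type IV(1,1) splits off `S` of type I(2) ∕ II(1), Lemma (3.4) in common-quotient form):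
  the shape `(3,2)` and the dimension-5 theorem with the residual hypothesis reduced to `hCM` — whenever `X ∼ T × S` with `T`,
  `S` both simple, they are NOT BOTH OF CM TYPE —
  **`IsRiemannForm.forall_divisorClasses_powPeriod_eq_hodgeClasses_of_not_isSimple_of_finrank_eq_five_of_not_and`**,
  **`IsRiemannForm.hodgeGroup_eq_lefschetzGroup_of_not_isSimple_of_finrank_eq_five_of_not_and`**, the `IsAbelianVariety.` and
  isogeny forms.  The ONLY class of non-simple fivefolds outside (e) ∕ (f) not covered (-- TODO(general form)): `X ∼ T × S`
  with `T` a simple CM threefold and `S` a simple CM surface ((5.10) with `Y₁`, `Y₂` of CM type, the Galois-group comparison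
  «the Galois group of the Galois closure of `F₂` … cannot be isomorphic to the group we have for `Hg(Y₁)`», p0010 L30–L45).
* §5 (g55-#13, appended) NO RESIDUAL after g55-#12 `ComplexTorusSimpleCMThreefoldTimesCMSurfaceHodgeGroup` ((5.10) with both
  factors of CM type: the cocharacter splitting of g55-#10, parity in place of the Galois-group comparison): the shape `(3,2)`
  and THE DIMENSION-5 THEOREM WITH ONLY MOONEN–ZARHIN'S OWN HYPOTHESES — no simple abelian fourfold factor (`h4`) and not of the
  forms (e) ∕ (f) (`hef`) —
  **`IsRiemannForm.forall_divisorClasses_powPeriod_eq_hodgeClasses_of_not_isSimple_of_finrank_eq_five_of_forall_not_isIsogenous_of_forall_isEmpty`**,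
  **`IsRiemannForm.hodgeGroup_eq_lefschetzGroup_of_not_isSimple_of_finrank_eq_five_of_forall_not_isIsogenous_of_forall_isEmpty`**,
  the `IsAbelianVariety.` and isogeny forms: «if `X` has no simple factor of dimension 4 then `Hg(X) = Sp_D(V,φ)` and
  `ℬ•(Xⁿ) = 𝒟•(Xⁿ)` for every `n ≥ 1`» for every NON-SIMPLE polarised abelian fivefold outside (e) ∕ (f).
-/

noncomputable section

open Module Matrix Complex Function NumberField

namespace Literature.Geometry.Kaehler

namespace ComplexTorus

/-! ### §0 Plumbing -/

section Plumbing

variable {ι₁ ι₂ ι₃ : Type*} [Fintype ι₁] [Fintype ι₂] [Fintype ι₃] [DecidableEq ι₁] [DecidableEq ι₂] [DecidableEq ι₃]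
  {F₁ F₂ F₃ : Type*} [NormedAddCommGroup F₁] [NormedSpace ℂ F₁] [NormedAddCommGroup F₂] [NormedSpace ℂ F₂]
  [NormedAddCommGroup F₃] [NormedSpace ℂ F₃]

/-- **`(A × B) × C ≅ (A × C) × B`.** [cite: Lange2023AbelianVarietiesComplex, §1.1.2 (products, p. 21)] -/
private theorem isIsomorphic_prod_prod_swap₅₈ (A : (ι₁ → ℝ) ≃L[ℝ] F₁) (B : (ι₂ → ℝ) ≃L[ℝ] F₂) (C : (ι₃ → ℝ) ≃L[ℝ] F₃) :
    IsIsomorphic (prodPeriod (prodPeriod A B) C) (prodPeriod (prodPeriod A C) B) :=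
  ((isIsomorphic_prodPeriod_assoc A B C).trans ((IsIsomorphic.refl A).prod (isIsomorphic_prodPeriod_comm B C))).trans
    (isIsomorphic_prodPeriod_assoc A C B).symm

end Plumbing

/-! ## §1 The ordered Poincaré shapes `(4,1)` and `(3,2)` -/

section Shapes

variable {ι : Type} [Fintype ι] [DecidableEq ι] {F : Type} [NormedAddCommGroup F] [NormedSpace ℂ F] {Φ : (ι → ℝ) ≃L[ℝ] F}
  {κ₁ κ₂ : Type} [Fintype κ₁] [DecidableEq κ₁] [Fintype κ₂] [DecidableEq κ₂]
  {E₁ E₂ : Type} [NormedAddCommGroup E₁] [NormedSpace ℂ E₁] [FiniteDimensional ℂ E₁] [NormedAddCommGroup E₂]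
  [NormedSpace ℂ E₂] [FiniteDimensional ℂ E₂] {Ψ₁ : (κ₁ → ℝ) ≃L[ℝ] E₁} {Ψ₂ : (κ₂ → ℝ) ≃L[ℝ] E₂}
  {η₁ : E₁ [⋀^Fin 2]→L[ℝ] ℝ} {η₂ : E₂ [⋀^Fin 2]→L[ℝ] ℝ}

omit [FiniteDimensional ℂ E₂] in
/-- **SHAPE `(4,1)`: `X ∼ A × C` with `A` a polarised abelian fourfold and `C` a one-dimensional complex torus, `X` without a
simple fourfold factor and outside (e) ∕ (f) ⟹ `X` satisfies (D)** — `C ≅ E_τ`, `A` is not simple (`h4`), ✔ g55-#2.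
[cite: MoonenZarhin1999LowDim, Thm. (0.2) (4) (p0002 L1–L8), §5 (5.7), (5.9), (5.11) (p0009 L132 – p0011 L5)] [cite: Lange2023AbelianVarietiesComplex, §1.1.6 Exercise (1)(a) and §1.1.2 Cor. 1.1.16] -/
theorem IsIsogenous.forall_divisorClasses_powPeriod_eq_hodgeClasses_of_prod_of_finrank_eq_four_one
    (hiso : IsIsogenous Φ (prodPeriod Ψ₁ Ψ₂)) (hη₁ : IsRiemannForm Ψ₁ η₁) (h4₁ : finrank ℂ E₁ = 4) (h1₂ : finrank ℂ E₂ = 1)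
    (h4 : ∀ {κ' : Type} [Fintype κ'] [DecidableEq κ'] {E' : Type} [NormedAddCommGroup E'] [NormedSpace ℂ E']
      [FiniteDimensional ℂ E'] {Ψ' : (κ' → ℝ) ≃L[ℝ] E'} {η' : E' [⋀^Fin 2]→L[ℝ] ℝ}, IsRiemannForm Ψ' η' →
      finrank ℂ E' = 4 → IsSimple Ψ' → ∀ {τ : ℂ} (hτ : τ.im ≠ 0), ¬ IsIsogenous Φ (prodPeriod Ψ' (ellipticPeriod hτ)))
    (hef : ∀ {κ' : Type} [Fintype κ'] [DecidableEq κ'] {E' : Type} [NormedAddCommGroup E'] [NormedSpace ℂ E']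
      [FiniteDimensional ℂ E'] {Ψ' : (κ' → ℝ) ≃L[ℝ] E'} {η' : E' [⋀^Fin 2]→L[ℝ] ℝ}, IsRiemannForm Ψ' η' →
      finrank ℂ E' = 3 → IsSimple Ψ' → ∀ {σ : ℂ} (hσ : σ.im ≠ 0) {ρ : ℂ} (hρ : ρ.im ≠ 0),
      IsIsogenous Φ (prodPeriod (prodPeriod Ψ' (ellipticPeriod hσ)) (ellipticPeriod hρ)) → ellipticEnd hρ ≠ ⊥ →
      IsEmpty (Algebra.adjoin ℚ {ρ} →ₐ[ℚ] endAlgRat Ψ')) :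
    ∀ k p, divisorClasses (powPeriod Φ k) p = hodgeClasses (powPeriod Φ k) p := by
  obtain ⟨τ, hτ, e⟩ := exists_isIsomorphic_ellipticPeriod Ψ₂ h1₂
  have hX : IsIsogenous Φ (prodPeriod Ψ₁ (ellipticPeriod hτ)) :=
    IsIsogenous.trans _ _ _ hiso ((IsIsomorphic.refl Ψ₁).prod e).isIsogenous
  have hA : ¬ IsSimple Ψ₁ := fun hA ↦ h4 hη₁ h4₁ hA hτ hX
  exact hX.forall_divisorClasses_powPeriod_eq_hodgeClasses_of_prod_ellipticPeriod_of_not_isSimple_of_finrank_eq_four_of_forall_isEmpty_algHom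
    hτ hη₁ h4₁ hA hef

/-- **SHAPE `(3,2)`: `X ∼ T × S` with `T` a polarised abelian threefold and `S` a polarised abelian surface, outside (e) ∕ (f)
and outside the residual simple × simple classes ⟹ `X` satisfies (D)** — `S` non-simple: `X ∼ (T × E_a) × E_b` (✔ g55-#2);
`S` simple, `T` non-simple: `X ∼ (S' × S) × E_c` (✔ g55-#1); both simple: g55-#3.
[cite: MoonenZarhin1999LowDim, Thm. (0.2) (4) (p0002 L1–L8), §5 (5.6)–(5.8), (5.10)–(5.11) (p0009 L122 – p0011 L5)] [cite: Lange2023AbelianVarietiesComplex, §2.4.4 Thm. 2.4.25 and §1.1.2 Cor. 1.1.16] -/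
theorem IsIsogenous.forall_divisorClasses_powPeriod_eq_hodgeClasses_of_prod_of_finrank_eq_three_two_of_forall
    (hiso : IsIsogenous Φ (prodPeriod Ψ₁ Ψ₂)) (hη₁ : IsRiemannForm Ψ₁ η₁) (hη₂ : IsRiemannForm Ψ₂ η₂) (h3₁ : finrank ℂ E₁ = 3)
    (h2₂ : finrank ℂ E₂ = 2)
    (hef : ∀ {κ' : Type} [Fintype κ'] [DecidableEq κ'] {E' : Type} [NormedAddCommGroup E'] [NormedSpace ℂ E']
      [FiniteDimensional ℂ E'] {Ψ' : (κ' → ℝ) ≃L[ℝ] E'} {η' : E' [⋀^Fin 2]→L[ℝ] ℝ}, IsRiemannForm Ψ' η' →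
      finrank ℂ E' = 3 → IsSimple Ψ' → ∀ {σ : ℂ} (hσ : σ.im ≠ 0) {ρ : ℂ} (hρ : ρ.im ≠ 0),
      IsIsogenous Φ (prodPeriod (prodPeriod Ψ' (ellipticPeriod hσ)) (ellipticPeriod hρ)) → ellipticEnd hρ ≠ ⊥ →
      IsEmpty (Algebra.adjoin ℚ {ρ} →ₐ[ℚ] endAlgRat Ψ'))
    (hTS : ∀ {κ₁' : Type} [Fintype κ₁'] [DecidableEq κ₁'] [Nonempty κ₁'] {E₁' : Type} [NormedAddCommGroup E₁']
      [NormedSpace ℂ E₁'] [FiniteDimensional ℂ E₁'] {Ψ₁' : (κ₁' → ℝ) ≃L[ℝ] E₁'} {η₁' : E₁' [⋀^Fin 2]→L[ℝ] ℝ}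
      {κ₂' : Type} [Fintype κ₂'] [DecidableEq κ₂'] [Nonempty κ₂'] {E₂' : Type} [NormedAddCommGroup E₂'] [NormedSpace ℂ E₂']
      [FiniteDimensional ℂ E₂'] {Ψ₂' : (κ₂' → ℝ) ≃L[ℝ] E₂'} {η₂' : E₂' [⋀^Fin 2]→L[ℝ] ℝ},
      IsRiemannForm Ψ₁' η₁' → finrank ℂ E₁' = 3 → ∀ hT : IsSimple Ψ₁', IsRiemannForm Ψ₂' η₂' → finrank ℂ E₂' = 2 →
      IsSimple Ψ₂' → IsIsogenous Φ (prodPeriod Ψ₁' Ψ₂') → IsCMField (centerField Ψ₁' hT) →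
      endAlgRat Ψ₂' = ⊥ ∨ ((∀ M ∈ hodgeGroup Ψ₁', ∀ N ∈ hodgeGroup Ψ₁', M * N = N * M) ∧
        ¬ ∀ M ∈ hodgeGroup Ψ₂', ∀ N ∈ hodgeGroup Ψ₂', M * N = N * M)) :
    ∀ k p, divisorClasses (powPeriod Φ k) p = hodgeClasses (powPeriod Φ k) p := by
  haveI : Nonempty κ₁ := Fintype.card_pos_iff.1 (by rw [card_eq_two_mul_finrank Ψ₁, h3₁]; norm_num)
  haveI : Nonempty κ₂ := Fintype.card_pos_iff.1 (by rw [card_eq_two_mul_finrank Ψ₂, h2₂]; norm_num)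
  by_cases hS : IsSimple Ψ₂
  swap
  · -- `S ∼ E_a × E_b`: `X ∼ T × (E_a × E_b) ≅ (T × E_a) × E_b`
    obtain ⟨V, hV, hVc, hW, hWc, hrV, hrW, hSiso, -⟩ := hη₂.exists_isIsogenous_prod_elliptic_of_not_isSimple h2₂ hS
    have hdV : finrank ℂ (cxSpan Ψ₂ V) = 1 := by
      have h := subRank_eq_two_mul_finrank Ψ₂ hV hVc
      omega
    have hdW : finrank ℂ (cxSpan Ψ₂ (orthSubspace Ψ₂ η₂ V)) = 1 := by
      have h := subRank_eq_two_mul_finrank Ψ₂ hW hWc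
      omega
    obtain ⟨a, ha, ea⟩ := exists_isIsomorphic_ellipticPeriod (subtorusPeriod Ψ₂ V hV hVc) hdV
    obtain ⟨b, hb, eb⟩ := exists_isIsomorphic_ellipticPeriod (subtorusPeriod Ψ₂ (orthSubspace Ψ₂ η₂ V) hW hWc) hdW
    have hSab : IsIsogenous Ψ₂ (prodPeriod (ellipticPeriod ha) (ellipticPeriod hb)) :=
      IsIsogenous.trans _ _ _ hSiso (ea.prod eb).isIsogenous
    have hX : IsIsogenous Φ (prodPeriod (prodPeriod Ψ₁ (ellipticPeriod ha)) (ellipticPeriod hb)) :=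
      IsIsogenous.trans _ _ _ (IsIsogenous.trans _ _ _ hiso ((IsIsogenous.refl Ψ₁).prod hSab))
        (isIsomorphic_prodPeriod_assoc Ψ₁ (ellipticPeriod ha) (ellipticPeriod hb)).symm.isIsogenous
    have hX' : IsIsogenous Φ (prodPeriod (prodPeriod Ψ₁ (ellipticPeriod hb)) (ellipticPeriod ha)) :=
      IsIsogenous.trans _ _ _ hX (isIsomorphic_prod_prod_swap₅₈ Ψ₁ (ellipticPeriod ha) (ellipticPeriod hb)).isIsogenous
    exact hX.forall_divisorClasses_powPeriod_eq_hodgeClasses_of_prod_ellipticPeriod_prod_ellipticPeriod_of_finrank_eq_three_of_forall_isEmpty_algHom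
      ha hb hη₁ h3₁ fun hT ↦ ⟨fun hE ↦ hef hη₁ h3₁ hT hb ha hX' hE, fun hE ↦ hef hη₁ h3₁ hT ha hb hX hE⟩
  by_cases hT : IsSimple Ψ₁
  swap
  · -- `T ∼ S' × E_c`: `X ∼ (S' × E_c) × S ≅ (S' × S) × E_c`
    obtain ⟨V, hV, hVc, c, hc, h2', hTiso⟩ :=
      hη₁.exists_isIsogenous_subtorusPeriod_prod_ellipticPeriod_of_not_isSimple_of_finrank_eq_three h3₁ hT
    have hX : IsIsogenous Φ (prodPeriod (prodPeriod (subtorusPeriod Ψ₁ V hV hVc) Ψ₂) (ellipticPeriod hc)) :=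
      IsIsogenous.trans _ _ _ (IsIsogenous.trans _ _ _ hiso (hTiso.prod (IsIsogenous.refl Ψ₂)))
        (isIsomorphic_prod_prod_swap₅₈ (subtorusPeriod Ψ₁ V hV hVc) (ellipticPeriod hc) Ψ₂).isIsogenous
    exact hX.forall_powPeriod_divisorClasses_eq_hodgeClasses_iff.2
      ((isRiemannForm_restrict Ψ₁ hη₁ hV hVc).forall_divisorClasses_powPeriod_prod_prod_ellipticPeriod_eq_hodgeClasses_of_finrank_eq_two_two
        hc hη₂ h2' h2₂)
  · -- both simple: g55-#3
    exact hiso.forall_divisorClasses_powPeriod_eq_hodgeClasses_of_prod_of_finrank_eq_three_two hT hS hη₁ hη₂ h3₁ h2₂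
      (hTS hη₁ h3₁ hT hη₂ h2₂ hS hiso)

end Shapes

/-! ## §2 The dimension-`5` theorem -/

section Fivefold

variable {κ : Type} [Fintype κ] [DecidableEq κ] {E : Type} [NormedAddCommGroup E] [NormedSpace ℂ E]
  [FiniteDimensional ℂ E] {Ψ : (κ → ℝ) ≃L[ℝ] E} {η : E [⋀^Fin 2]→L[ℝ] ℝ}

/-- **MOONEN–ZARHIN THM. (0.2) (4) FOR NON-SIMPLE COMPLEX ABELIAN FIVEFOLDS (DECOMPOSITION-FREE): a polarised complex abelian
variety `X` of dimension `5` which is NOT SIMPLE, has NO SIMPLE FOURFOLD AS AN ISOGENY FACTOR (`h4`: «if `X` has no simple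
factor of dimension 4»; this also excludes (g)), is NOT IN THE CASES (e), (f) (`hef`), and satisfies the residual hypothesis
`hTS` on its decompositions `X ∼ T × S` into a simple threefold with centre of Type IV and a simple surface (see the module
docstring; -- TODO(general form)), SATISFIES CONDITION (D): `ℬ•(Xⁿ) = 𝒟•(Xⁿ)` for all `n`** — every Hodge class on every
power of `X` is a polynomial in divisor classes.  PROOF: Poincaré `X ∼ A × B` with `(dim A, dim B) ∈ {(4,1), (1,4), (3,2),
(2,3)}` and §1.
[cite: MoonenZarhin1999LowDim, Thm. (0.2) (4) (p0002 L1–L8), cases (a), (e)–(g) (p0001 L77–L80, L127–L140), §5 (5.6)–(5.12) (p0009 L110 – p0011 L12)]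
[cite: Lange2023AbelianVarietiesComplex, §2.4.4 Thm. 2.4.25] [cite: SwinnertonDyer1974AbelianVarieties, Ch. II §7 Cor. 3] -/
theorem IsRiemannForm.forall_divisorClasses_powPeriod_eq_hodgeClasses_of_not_isSimple_of_finrank_eq_five
    (hη : IsRiemannForm Ψ η) (h5 : finrank ℂ E = 5) (hX : ¬ IsSimple Ψ)
    (h4 : ∀ {κ' : Type} [Fintype κ'] [DecidableEq κ'] {E' : Type} [NormedAddCommGroup E'] [NormedSpace ℂ E']
      [FiniteDimensional ℂ E'] {Ψ' : (κ' → ℝ) ≃L[ℝ] E'} {η' : E' [⋀^Fin 2]→L[ℝ] ℝ}, IsRiemannForm Ψ' η' →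
      finrank ℂ E' = 4 → IsSimple Ψ' → ∀ {τ : ℂ} (hτ : τ.im ≠ 0), ¬ IsIsogenous Ψ (prodPeriod Ψ' (ellipticPeriod hτ)))
    (hef : ∀ {κ' : Type} [Fintype κ'] [DecidableEq κ'] {E' : Type} [NormedAddCommGroup E'] [NormedSpace ℂ E']
      [FiniteDimensional ℂ E'] {Ψ' : (κ' → ℝ) ≃L[ℝ] E'} {η' : E' [⋀^Fin 2]→L[ℝ] ℝ}, IsRiemannForm Ψ' η' →
      finrank ℂ E' = 3 → IsSimple Ψ' → ∀ {σ : ℂ} (hσ : σ.im ≠ 0) {ρ : ℂ} (hρ : ρ.im ≠ 0),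
      IsIsogenous Ψ (prodPeriod (prodPeriod Ψ' (ellipticPeriod hσ)) (ellipticPeriod hρ)) → ellipticEnd hρ ≠ ⊥ →
      IsEmpty (Algebra.adjoin ℚ {ρ} →ₐ[ℚ] endAlgRat Ψ'))
    (hTS : ∀ {κ₁' : Type} [Fintype κ₁'] [DecidableEq κ₁'] [Nonempty κ₁'] {E₁' : Type} [NormedAddCommGroup E₁']
      [NormedSpace ℂ E₁'] [FiniteDimensional ℂ E₁'] {Ψ₁' : (κ₁' → ℝ) ≃L[ℝ] E₁'} {η₁' : E₁' [⋀^Fin 2]→L[ℝ] ℝ}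
      {κ₂' : Type} [Fintype κ₂'] [DecidableEq κ₂'] [Nonempty κ₂'] {E₂' : Type} [NormedAddCommGroup E₂'] [NormedSpace ℂ E₂']
      [FiniteDimensional ℂ E₂'] {Ψ₂' : (κ₂' → ℝ) ≃L[ℝ] E₂'} {η₂' : E₂' [⋀^Fin 2]→L[ℝ] ℝ},
      IsRiemannForm Ψ₁' η₁' → finrank ℂ E₁' = 3 → ∀ hT : IsSimple Ψ₁', IsRiemannForm Ψ₂' η₂' → finrank ℂ E₂' = 2 →
      IsSimple Ψ₂' → IsIsogenous Ψ (prodPeriod Ψ₁' Ψ₂') → IsCMField (centerField Ψ₁' hT) →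
      endAlgRat Ψ₂' = ⊥ ∨ ((∀ M ∈ hodgeGroup Ψ₁', ∀ N ∈ hodgeGroup Ψ₁', M * N = N * M) ∧
        ¬ ∀ M ∈ hodgeGroup Ψ₂', ∀ N ∈ hodgeGroup Ψ₂', M * N = N * M)) :
    ∀ k p, divisorClasses (powPeriod Ψ k) p = hodgeClasses (powPeriod Ψ k) p := by
  obtain ⟨V, hV, hVc, hW, hWc, h0V, h0W, hiso⟩ := hη.exists_isIsogenous_prod_of_not_isSimple Ψ hX
  have hcard := hiso.card_eq
  rw [Fintype.card_sum, Fintype.card_fin, Fintype.card_fin, card_eq_two_mul_finrank Ψ, h5] at hcard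
  have hVd := subRank_eq_two_mul_finrank Ψ hV hVc
  have hWd := subRank_eq_two_mul_finrank Ψ hW hWc
  -- the complementary Poincaré subtori, polarised by restriction
  have hA := isRiemannForm_restrict Ψ hη hV hVc
  have hB := isRiemannForm_restrict Ψ hη hW hWc
  -- `X ∼ B × A` as well
  have hiso' : IsIsogenous Ψ (prodPeriod (subtorusPeriod Ψ (orthSubspace Ψ η V) hW hWc) (subtorusPeriod Ψ V hV hVc)) :=
    IsIsogenous.trans _ _ _ hiso
      (isIsomorphic_prodPeriod_comm (subtorusPeriod Ψ V hV hVc) (subtorusPeriod Ψ (orthSubspace Ψ η V) hW hWc)).isIsogenous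
  have hcases : (finrank ℂ (cxSpan Ψ V) = 4 ∧ finrank ℂ (cxSpan Ψ (orthSubspace Ψ η V)) = 1) ∨
      (finrank ℂ (cxSpan Ψ V) = 1 ∧ finrank ℂ (cxSpan Ψ (orthSubspace Ψ η V)) = 4) ∨
      (finrank ℂ (cxSpan Ψ V) = 3 ∧ finrank ℂ (cxSpan Ψ (orthSubspace Ψ η V)) = 2) ∨
      (finrank ℂ (cxSpan Ψ V) = 2 ∧ finrank ℂ (cxSpan Ψ (orthSubspace Ψ η V)) = 3) := by omega
  rcases hcases with ⟨ha, hb⟩ | ⟨ha, hb⟩ | ⟨ha, hb⟩ | ⟨ha, hb⟩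
  · exact hiso.forall_divisorClasses_powPeriod_eq_hodgeClasses_of_prod_of_finrank_eq_four_one hA ha hb h4 hef
  · exact hiso'.forall_divisorClasses_powPeriod_eq_hodgeClasses_of_prod_of_finrank_eq_four_one hB hb ha h4 hef
  · exact hiso.forall_divisorClasses_powPeriod_eq_hodgeClasses_of_prod_of_finrank_eq_three_two_of_forall hA hB ha hb hef hTS
  · exact hiso'.forall_divisorClasses_powPeriod_eq_hodgeClasses_of_prod_of_finrank_eq_three_two_of_forall hB hA hb ha hef hTS

/-- The `IsAbelianVariety` form: a non-simple complex abelian fivefold without a simple fourfold factor, outside (e) ∕ (f) and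
outside the residual classes satisfies (D). [cite: MoonenZarhin1999LowDim, Thm. (0.2) (4) (p0002 L1–L8)] -/
theorem IsAbelianVariety.forall_divisorClasses_powPeriod_eq_hodgeClasses_of_not_isSimple_of_finrank_eq_five
    (hA : IsAbelianVariety Ψ) (h5 : finrank ℂ E = 5) (hX : ¬ IsSimple Ψ)
    (h4 : ∀ {κ' : Type} [Fintype κ'] [DecidableEq κ'] {E' : Type} [NormedAddCommGroup E'] [NormedSpace ℂ E']
      [FiniteDimensional ℂ E'] {Ψ' : (κ' → ℝ) ≃L[ℝ] E'} {η' : E' [⋀^Fin 2]→L[ℝ] ℝ}, IsRiemannForm Ψ' η' →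
      finrank ℂ E' = 4 → IsSimple Ψ' → ∀ {τ : ℂ} (hτ : τ.im ≠ 0), ¬ IsIsogenous Ψ (prodPeriod Ψ' (ellipticPeriod hτ)))
    (hef : ∀ {κ' : Type} [Fintype κ'] [DecidableEq κ'] {E' : Type} [NormedAddCommGroup E'] [NormedSpace ℂ E']
      [FiniteDimensional ℂ E'] {Ψ' : (κ' → ℝ) ≃L[ℝ] E'} {η' : E' [⋀^Fin 2]→L[ℝ] ℝ}, IsRiemannForm Ψ' η' →
      finrank ℂ E' = 3 → IsSimple Ψ' → ∀ {σ : ℂ} (hσ : σ.im ≠ 0) {ρ : ℂ} (hρ : ρ.im ≠ 0),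
      IsIsogenous Ψ (prodPeriod (prodPeriod Ψ' (ellipticPeriod hσ)) (ellipticPeriod hρ)) → ellipticEnd hρ ≠ ⊥ →
      IsEmpty (Algebra.adjoin ℚ {ρ} →ₐ[ℚ] endAlgRat Ψ'))
    (hTS : ∀ {κ₁' : Type} [Fintype κ₁'] [DecidableEq κ₁'] [Nonempty κ₁'] {E₁' : Type} [NormedAddCommGroup E₁']
      [NormedSpace ℂ E₁'] [FiniteDimensional ℂ E₁'] {Ψ₁' : (κ₁' → ℝ) ≃L[ℝ] E₁'} {η₁' : E₁' [⋀^Fin 2]→L[ℝ] ℝ}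
      {κ₂' : Type} [Fintype κ₂'] [DecidableEq κ₂'] [Nonempty κ₂'] {E₂' : Type} [NormedAddCommGroup E₂'] [NormedSpace ℂ E₂']
      [FiniteDimensional ℂ E₂'] {Ψ₂' : (κ₂' → ℝ) ≃L[ℝ] E₂'} {η₂' : E₂' [⋀^Fin 2]→L[ℝ] ℝ},
      IsRiemannForm Ψ₁' η₁' → finrank ℂ E₁' = 3 → ∀ hT : IsSimple Ψ₁', IsRiemannForm Ψ₂' η₂' → finrank ℂ E₂' = 2 →
      IsSimple Ψ₂' → IsIsogenous Ψ (prodPeriod Ψ₁' Ψ₂') → IsCMField (centerField Ψ₁' hT) →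
      endAlgRat Ψ₂' = ⊥ ∨ ((∀ M ∈ hodgeGroup Ψ₁', ∀ N ∈ hodgeGroup Ψ₁', M * N = N * M) ∧
        ¬ ∀ M ∈ hodgeGroup Ψ₂', ∀ N ∈ hodgeGroup Ψ₂', M * N = N * M)) :
    ∀ k p, divisorClasses (powPeriod Ψ k) p = hodgeClasses (powPeriod Ψ k) p := by
  obtain ⟨η, hη⟩ := hA
  exact hη.forall_divisorClasses_powPeriod_eq_hodgeClasses_of_not_isSimple_of_finrank_eq_five h5 hX h4 hef hTS

/-- **… AND `Hg(X) = Sp_D(V,φ)`** (real points `Hg(X)(ℝ) = S(X)(ℝ)`: the Hodge group is the full centraliser of `End⁰(X)` in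
the symplectic group of the polarisation) — from (D) by Gordon's Thm. 7.5 (1) ⟹ (2) (the tree's A4-103).
[cite: MoonenZarhin1999LowDim, Thm. (0.2) (4) (p0002 L5–L8: «then `Hg(X) = Sp_D(V,φ)`»)] [cite: Gordon1999HodgeAVSurvey, Thm. 7.5 (1) ⟺ (2)]
[cite: Milne1999LefschetzClasses, §4 Prop. 4.8] -/
theorem IsRiemannForm.hodgeGroup_eq_lefschetzGroup_of_not_isSimple_of_finrank_eq_five
    (hη : IsRiemannForm Ψ η) (h5 : finrank ℂ E = 5) (hX : ¬ IsSimple Ψ)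
    (h4 : ∀ {κ' : Type} [Fintype κ'] [DecidableEq κ'] {E' : Type} [NormedAddCommGroup E'] [NormedSpace ℂ E']
      [FiniteDimensional ℂ E'] {Ψ' : (κ' → ℝ) ≃L[ℝ] E'} {η' : E' [⋀^Fin 2]→L[ℝ] ℝ}, IsRiemannForm Ψ' η' →
      finrank ℂ E' = 4 → IsSimple Ψ' → ∀ {τ : ℂ} (hτ : τ.im ≠ 0), ¬ IsIsogenous Ψ (prodPeriod Ψ' (ellipticPeriod hτ)))
    (hef : ∀ {κ' : Type} [Fintype κ'] [DecidableEq κ'] {E' : Type} [NormedAddCommGroup E'] [NormedSpace ℂ E']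
      [FiniteDimensional ℂ E'] {Ψ' : (κ' → ℝ) ≃L[ℝ] E'} {η' : E' [⋀^Fin 2]→L[ℝ] ℝ}, IsRiemannForm Ψ' η' →
      finrank ℂ E' = 3 → IsSimple Ψ' → ∀ {σ : ℂ} (hσ : σ.im ≠ 0) {ρ : ℂ} (hρ : ρ.im ≠ 0),
      IsIsogenous Ψ (prodPeriod (prodPeriod Ψ' (ellipticPeriod hσ)) (ellipticPeriod hρ)) → ellipticEnd hρ ≠ ⊥ →
      IsEmpty (Algebra.adjoin ℚ {ρ} →ₐ[ℚ] endAlgRat Ψ'))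
    (hTS : ∀ {κ₁' : Type} [Fintype κ₁'] [DecidableEq κ₁'] [Nonempty κ₁'] {E₁' : Type} [NormedAddCommGroup E₁']
      [NormedSpace ℂ E₁'] [FiniteDimensional ℂ E₁'] {Ψ₁' : (κ₁' → ℝ) ≃L[ℝ] E₁'} {η₁' : E₁' [⋀^Fin 2]→L[ℝ] ℝ}
      {κ₂' : Type} [Fintype κ₂'] [DecidableEq κ₂'] [Nonempty κ₂'] {E₂' : Type} [NormedAddCommGroup E₂'] [NormedSpace ℂ E₂']
      [FiniteDimensional ℂ E₂'] {Ψ₂' : (κ₂' → ℝ) ≃L[ℝ] E₂'} {η₂' : E₂' [⋀^Fin 2]→L[ℝ] ℝ},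
      IsRiemannForm Ψ₁' η₁' → finrank ℂ E₁' = 3 → ∀ hT : IsSimple Ψ₁', IsRiemannForm Ψ₂' η₂' → finrank ℂ E₂' = 2 →
      IsSimple Ψ₂' → IsIsogenous Ψ (prodPeriod Ψ₁' Ψ₂') → IsCMField (centerField Ψ₁' hT) →
      endAlgRat Ψ₂' = ⊥ ∨ ((∀ M ∈ hodgeGroup Ψ₁', ∀ N ∈ hodgeGroup Ψ₁', M * N = N * M) ∧
        ¬ ∀ M ∈ hodgeGroup Ψ₂', ∀ N ∈ hodgeGroup Ψ₂', M * N = N * M)) :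
    hodgeGroup Ψ = lefschetzGroup Ψ η := by
  obtain ⟨G, hG⟩ := hη.exists_ratMatrix_latticeGram
  exact ((hη.forall_divisorClasses_powPeriod_eq_hodgeClasses_iff_eq_and_hodgeGroup_eq_lefschetzGroup hG (by omega)).1
    (hη.forall_divisorClasses_powPeriod_eq_hodgeClasses_of_not_isSimple_of_finrank_eq_five h5 hX h4 hef hTS)).2

end Fivefold

section FivefoldIsogenous

variable {ι : Type*} [Fintype ι] [DecidableEq ι] {F : Type*} [NormedAddCommGroup F] [NormedSpace ℂ F]
  {Φ : (ι → ℝ) ≃L[ℝ] F}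
  {κ : Type} [Fintype κ] [DecidableEq κ] {E : Type} [NormedAddCommGroup E] [NormedSpace ℂ E] [FiniteDimensional ℂ E]
  {Ψ : (κ → ℝ) ≃L[ℝ] E} {η : E [⋀^Fin 2]→L[ℝ] ℝ}

/-- **Every complex torus isogenous to such a fivefold satisfies (D)** ((D) is an isogeny invariant; the hypotheses are read on
the polarised model `X`). [cite: MoonenZarhin1999LowDim, Thm. (0.2) (4) (p0002 L1–L8)] [cite: Lange2023AbelianVarietiesComplex, §1.1.2 Cor. 1.1.16] -/
theorem IsIsogenous.forall_divisorClasses_powPeriod_eq_hodgeClasses_of_not_isSimple_of_finrank_eq_five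
    (hΦ : IsIsogenous Φ Ψ) (hη : IsRiemannForm Ψ η) (h5 : finrank ℂ E = 5) (hX : ¬ IsSimple Ψ)
    (h4 : ∀ {κ' : Type} [Fintype κ'] [DecidableEq κ'] {E' : Type} [NormedAddCommGroup E'] [NormedSpace ℂ E']
      [FiniteDimensional ℂ E'] {Ψ' : (κ' → ℝ) ≃L[ℝ] E'} {η' : E' [⋀^Fin 2]→L[ℝ] ℝ}, IsRiemannForm Ψ' η' →
      finrank ℂ E' = 4 → IsSimple Ψ' → ∀ {τ : ℂ} (hτ : τ.im ≠ 0), ¬ IsIsogenous Ψ (prodPeriod Ψ' (ellipticPeriod hτ)))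
    (hef : ∀ {κ' : Type} [Fintype κ'] [DecidableEq κ'] {E' : Type} [NormedAddCommGroup E'] [NormedSpace ℂ E']
      [FiniteDimensional ℂ E'] {Ψ' : (κ' → ℝ) ≃L[ℝ] E'} {η' : E' [⋀^Fin 2]→L[ℝ] ℝ}, IsRiemannForm Ψ' η' →
      finrank ℂ E' = 3 → IsSimple Ψ' → ∀ {σ : ℂ} (hσ : σ.im ≠ 0) {ρ : ℂ} (hρ : ρ.im ≠ 0),
      IsIsogenous Ψ (prodPeriod (prodPeriod Ψ' (ellipticPeriod hσ)) (ellipticPeriod hρ)) → ellipticEnd hρ ≠ ⊥ →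
      IsEmpty (Algebra.adjoin ℚ {ρ} →ₐ[ℚ] endAlgRat Ψ'))
    (hTS : ∀ {κ₁' : Type} [Fintype κ₁'] [DecidableEq κ₁'] [Nonempty κ₁'] {E₁' : Type} [NormedAddCommGroup E₁']
      [NormedSpace ℂ E₁'] [FiniteDimensional ℂ E₁'] {Ψ₁' : (κ₁' → ℝ) ≃L[ℝ] E₁'} {η₁' : E₁' [⋀^Fin 2]→L[ℝ] ℝ}
      {κ₂' : Type} [Fintype κ₂'] [DecidableEq κ₂'] [Nonempty κ₂'] {E₂' : Type} [NormedAddCommGroup E₂'] [NormedSpace ℂ E₂']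
      [FiniteDimensional ℂ E₂'] {Ψ₂' : (κ₂' → ℝ) ≃L[ℝ] E₂'} {η₂' : E₂' [⋀^Fin 2]→L[ℝ] ℝ},
      IsRiemannForm Ψ₁' η₁' → finrank ℂ E₁' = 3 → ∀ hT : IsSimple Ψ₁', IsRiemannForm Ψ₂' η₂' → finrank ℂ E₂' = 2 →
      IsSimple Ψ₂' → IsIsogenous Ψ (prodPeriod Ψ₁' Ψ₂') → IsCMField (centerField Ψ₁' hT) →
      endAlgRat Ψ₂' = ⊥ ∨ ((∀ M ∈ hodgeGroup Ψ₁', ∀ N ∈ hodgeGroup Ψ₁', M * N = N * M) ∧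
        ¬ ∀ M ∈ hodgeGroup Ψ₂', ∀ N ∈ hodgeGroup Ψ₂', M * N = N * M)) :
    ∀ k p, divisorClasses (powPeriod Φ k) p = hodgeClasses (powPeriod Φ k) p :=
  hΦ.forall_powPeriod_divisorClasses_eq_hodgeClasses_iff.2
    (hη.forall_divisorClasses_powPeriod_eq_hodgeClasses_of_not_isSimple_of_finrank_eq_five h5 hX h4 hef hTS)

end FivefoldIsogenous

/-! ## §3 The smaller residual (g55-#6): `T` of type IV(1,1) × `S` CM is covered -/

section ShapesSharper

variable {ι : Type} [Fintype ι] [DecidableEq ι] {F : Type} [NormedAddCommGroup F] [NormedSpace ℂ F] {Φ : (ι → ℝ) ≃L[ℝ] F}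
  {κ₁ κ₂ : Type} [Fintype κ₁] [DecidableEq κ₁] [Fintype κ₂] [DecidableEq κ₂]
  {E₁ E₂ : Type} [NormedAddCommGroup E₁] [NormedSpace ℂ E₁] [FiniteDimensional ℂ E₁] [NormedAddCommGroup E₂]
  [NormedSpace ℂ E₂] [FiniteDimensional ℂ E₂] {Ψ₁ : (κ₁ → ℝ) ≃L[ℝ] E₁} {Ψ₂ : (κ₂ → ℝ) ≃L[ℝ] E₂}
  {η₁ : E₁ [⋀^Fin 2]→L[ℝ] ℝ} {η₂ : E₂ [⋀^Fin 2]→L[ℝ] ℝ}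

/-- **SHAPE `(3,2)` WITH THE SMALLER RESIDUAL**: `X ∼ T × S` polarised of dimensions `3`, `2` (simple or not), outside
(e) ∕ (f), and — when both are simple with the centre of `End⁰(T)` a CM field — `End⁰(S) = ℚ`, or `T` CM and `S` not, or `T`
of type IV(1,1) and `S` CM ⟹ `X` satisfies (D).  As §1, the simple × simple case by g55-#5's dispatch.
[cite: MoonenZarhin1999LowDim, Thm. (0.2) (4) (p0002 L1–L8), §5 (5.6)–(5.8), (5.10)–(5.11) (p0009 L122 – p0011 L5), §3 Lemma (3.6)] [cite: Lange2023AbelianVarietiesComplex, §2.4.4 Thm. 2.4.25 and §1.1.2 Cor. 1.1.16] -/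
theorem IsIsogenous.forall_divisorClasses_powPeriod_eq_hodgeClasses_of_prod_of_finrank_eq_three_two_of_forall_of_isCMField_imp
    (hiso : IsIsogenous Φ (prodPeriod Ψ₁ Ψ₂)) (hη₁ : IsRiemannForm Ψ₁ η₁) (hη₂ : IsRiemannForm Ψ₂ η₂) (h3₁ : finrank ℂ E₁ = 3)
    (h2₂ : finrank ℂ E₂ = 2)
    (hef : ∀ {κ' : Type} [Fintype κ'] [DecidableEq κ'] {E' : Type} [NormedAddCommGroup E'] [NormedSpace ℂ E']
      [FiniteDimensional ℂ E'] {Ψ' : (κ' → ℝ) ≃L[ℝ] E'} {η' : E' [⋀^Fin 2]→L[ℝ] ℝ}, IsRiemannForm Ψ' η' →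
      finrank ℂ E' = 3 → IsSimple Ψ' → ∀ {σ : ℂ} (hσ : σ.im ≠ 0) {ρ : ℂ} (hρ : ρ.im ≠ 0),
      IsIsogenous Φ (prodPeriod (prodPeriod Ψ' (ellipticPeriod hσ)) (ellipticPeriod hρ)) → ellipticEnd hρ ≠ ⊥ →
      IsEmpty (Algebra.adjoin ℚ {ρ} →ₐ[ℚ] endAlgRat Ψ'))
    (hTS : ∀ {κ₁' : Type} [Fintype κ₁'] [DecidableEq κ₁'] [Nonempty κ₁'] {E₁' : Type} [NormedAddCommGroup E₁']
      [NormedSpace ℂ E₁'] [FiniteDimensional ℂ E₁'] {Ψ₁' : (κ₁' → ℝ) ≃L[ℝ] E₁'} {η₁' : E₁' [⋀^Fin 2]→L[ℝ] ℝ}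
      {κ₂' : Type} [Fintype κ₂'] [DecidableEq κ₂'] [Nonempty κ₂'] {E₂' : Type} [NormedAddCommGroup E₂'] [NormedSpace ℂ E₂']
      [FiniteDimensional ℂ E₂'] {Ψ₂' : (κ₂' → ℝ) ≃L[ℝ] E₂'} {η₂' : E₂' [⋀^Fin 2]→L[ℝ] ℝ},
      IsRiemannForm Ψ₁' η₁' → finrank ℂ E₁' = 3 → ∀ hT : IsSimple Ψ₁', IsRiemannForm Ψ₂' η₂' → finrank ℂ E₂' = 2 →
      IsSimple Ψ₂' → IsIsogenous Φ (prodPeriod Ψ₁' Ψ₂') → IsCMField (centerField Ψ₁' hT) →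
      endAlgRat Ψ₂' = ⊥ ∨ ((∀ M ∈ hodgeGroup Ψ₁', ∀ N ∈ hodgeGroup Ψ₁', M * N = N * M) ∧
        ¬ ∀ M ∈ hodgeGroup Ψ₂', ∀ N ∈ hodgeGroup Ψ₂', M * N = N * M) ∨
        (finrank ℚ (centerField Ψ₁' hT) = 2 ∧ ∀ M ∈ hodgeGroup Ψ₂', ∀ N ∈ hodgeGroup Ψ₂', M * N = N * M)) :
    ∀ k p, divisorClasses (powPeriod Φ k) p = hodgeClasses (powPeriod Φ k) p := by
  haveI : Nonempty κ₁ := Fintype.card_pos_iff.1 (by rw [card_eq_two_mul_finrank Ψ₁, h3₁]; norm_num)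
  haveI : Nonempty κ₂ := Fintype.card_pos_iff.1 (by rw [card_eq_two_mul_finrank Ψ₂, h2₂]; norm_num)
  by_cases hS : IsSimple Ψ₂
  swap
  · -- `S ∼ E_a × E_b`: `X ∼ T × (E_a × E_b) ≅ (T × E_a) × E_b`
    obtain ⟨V, hV, hVc, hW, hWc, hrV, hrW, hSiso, -⟩ := hη₂.exists_isIsogenous_prod_elliptic_of_not_isSimple h2₂ hS
    have hdV : finrank ℂ (cxSpan Ψ₂ V) = 1 := by
      have h := subRank_eq_two_mul_finrank Ψ₂ hV hVc
      omega
    have hdW : finrank ℂ (cxSpan Ψ₂ (orthSubspace Ψ₂ η₂ V)) = 1 := by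
      have h := subRank_eq_two_mul_finrank Ψ₂ hW hWc
      omega
    obtain ⟨a, ha, ea⟩ := exists_isIsomorphic_ellipticPeriod (subtorusPeriod Ψ₂ V hV hVc) hdV
    obtain ⟨b, hb, eb⟩ := exists_isIsomorphic_ellipticPeriod (subtorusPeriod Ψ₂ (orthSubspace Ψ₂ η₂ V) hW hWc) hdW
    have hSab : IsIsogenous Ψ₂ (prodPeriod (ellipticPeriod ha) (ellipticPeriod hb)) :=
      IsIsogenous.trans _ _ _ hSiso (ea.prod eb).isIsogenous
    have hX : IsIsogenous Φ (prodPeriod (prodPeriod Ψ₁ (ellipticPeriod ha)) (ellipticPeriod hb)) :=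
      IsIsogenous.trans _ _ _ (IsIsogenous.trans _ _ _ hiso ((IsIsogenous.refl Ψ₁).prod hSab))
        (isIsomorphic_prodPeriod_assoc Ψ₁ (ellipticPeriod ha) (ellipticPeriod hb)).symm.isIsogenous
    have hX' : IsIsogenous Φ (prodPeriod (prodPeriod Ψ₁ (ellipticPeriod hb)) (ellipticPeriod ha)) :=
      IsIsogenous.trans _ _ _ hX (isIsomorphic_prod_prod_swap₅₈ Ψ₁ (ellipticPeriod ha) (ellipticPeriod hb)).isIsogenous
    exact hX.forall_divisorClasses_powPeriod_eq_hodgeClasses_of_prod_ellipticPeriod_prod_ellipticPeriod_of_finrank_eq_three_of_forall_isEmpty_algHom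
      ha hb hη₁ h3₁ fun hT ↦ ⟨fun hE ↦ hef hη₁ h3₁ hT hb ha hX' hE, fun hE ↦ hef hη₁ h3₁ hT ha hb hX hE⟩
  by_cases hT : IsSimple Ψ₁
  swap
  · -- `T ∼ S' × E_c`: `X ∼ (S' × E_c) × S ≅ (S' × S) × E_c`
    obtain ⟨V, hV, hVc, c, hc, h2', hTiso⟩ :=
      hη₁.exists_isIsogenous_subtorusPeriod_prod_ellipticPeriod_of_not_isSimple_of_finrank_eq_three h3₁ hT
    have hX : IsIsogenous Φ (prodPeriod (prodPeriod (subtorusPeriod Ψ₁ V hV hVc) Ψ₂) (ellipticPeriod hc)) :=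
      IsIsogenous.trans _ _ _ (IsIsogenous.trans _ _ _ hiso (hTiso.prod (IsIsogenous.refl Ψ₂)))
        (isIsomorphic_prod_prod_swap₅₈ (subtorusPeriod Ψ₁ V hV hVc) (ellipticPeriod hc) Ψ₂).isIsogenous
    exact hX.forall_powPeriod_divisorClasses_eq_hodgeClasses_iff.2
      ((isRiemannForm_restrict Ψ₁ hη₁ hV hVc).forall_divisorClasses_powPeriod_prod_prod_ellipticPeriod_eq_hodgeClasses_of_finrank_eq_two_two
        hc hη₂ h2' h2₂)
  · -- both simple: g55-#5's sharper dispatch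
    exact hiso.forall_divisorClasses_powPeriod_eq_hodgeClasses_of_prod_of_finrank_eq_three_two_of_isCMField_imp hT hS hη₁ hη₂
      h3₁ h2₂ (hTS hη₁ h3₁ hT hη₂ h2₂ hS hiso)

end ShapesSharper

section FivefoldSharper

variable {κ : Type} [Fintype κ] [DecidableEq κ] {E : Type} [NormedAddCommGroup E] [NormedSpace ℂ E]
  [FiniteDimensional ℂ E] {Ψ : (κ → ℝ) ≃L[ℝ] E} {η : E [⋀^Fin 2]→L[ℝ] ℝ}

/-- **MOONEN–ZARHIN THM. (0.2) (4) FOR NON-SIMPLE FIVEFOLDS, DECOMPOSITION-FREE, WITH THE SMALLER RESIDUAL** (`T` of type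
IV(1,1) × `S` CM now covered by g55-#5): a polarised non-simple abelian fivefold without a simple fourfold isogeny factor
(`h4`), outside (e) ∕ (f) (`hef`), and with `hTS'` on its decompositions `X ∼ T × S` (both simple, centre of `End⁰(T)` CM:
`End⁰(S) = ℚ`, or `T` CM and `S` not, or `[Z(End⁰ T) : ℚ] = 2` and `S` CM) satisfies (D): `ℬ•(Xⁿ) = 𝒟•(Xⁿ)` for all `n`.
Still NOT covered (-- TODO(general form)): `T` of type IV(1,1) × `S` of type I(2) ∕ II(1), and `T` CM × `S` CM.
[cite: MoonenZarhin1999LowDim, Thm. (0.2) (4) (p0002 L1–L8), cases (a), (e)–(g) (p0001 L77–L80, L127–L140), §5 (5.6)–(5.12) (p0009 L110 – p0011 L12), §3 Lemma (3.6), §4 (4.1)–(4.2)]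
[cite: Lange2023AbelianVarietiesComplex, §2.4.4 Thm. 2.4.25] [cite: SwinnertonDyer1974AbelianVarieties, Ch. II §7 Cor. 3] -/
theorem IsRiemannForm.forall_divisorClasses_powPeriod_eq_hodgeClasses_of_not_isSimple_of_finrank_eq_five_of_isCMField_imp
    (hη : IsRiemannForm Ψ η) (h5 : finrank ℂ E = 5) (hX : ¬ IsSimple Ψ)
    (h4 : ∀ {κ' : Type} [Fintype κ'] [DecidableEq κ'] {E' : Type} [NormedAddCommGroup E'] [NormedSpace ℂ E']
      [FiniteDimensional ℂ E'] {Ψ' : (κ' → ℝ) ≃L[ℝ] E'} {η' : E' [⋀^Fin 2]→L[ℝ] ℝ}, IsRiemannForm Ψ' η' →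
      finrank ℂ E' = 4 → IsSimple Ψ' → ∀ {τ : ℂ} (hτ : τ.im ≠ 0), ¬ IsIsogenous Ψ (prodPeriod Ψ' (ellipticPeriod hτ)))
    (hef : ∀ {κ' : Type} [Fintype κ'] [DecidableEq κ'] {E' : Type} [NormedAddCommGroup E'] [NormedSpace ℂ E']
      [FiniteDimensional ℂ E'] {Ψ' : (κ' → ℝ) ≃L[ℝ] E'} {η' : E' [⋀^Fin 2]→L[ℝ] ℝ}, IsRiemannForm Ψ' η' →
      finrank ℂ E' = 3 → IsSimple Ψ' → ∀ {σ : ℂ} (hσ : σ.im ≠ 0) {ρ : ℂ} (hρ : ρ.im ≠ 0),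
      IsIsogenous Ψ (prodPeriod (prodPeriod Ψ' (ellipticPeriod hσ)) (ellipticPeriod hρ)) → ellipticEnd hρ ≠ ⊥ →
      IsEmpty (Algebra.adjoin ℚ {ρ} →ₐ[ℚ] endAlgRat Ψ'))
    (hTS : ∀ {κ₁' : Type} [Fintype κ₁'] [DecidableEq κ₁'] [Nonempty κ₁'] {E₁' : Type} [NormedAddCommGroup E₁']
      [NormedSpace ℂ E₁'] [FiniteDimensional ℂ E₁'] {Ψ₁' : (κ₁' → ℝ) ≃L[ℝ] E₁'} {η₁' : E₁' [⋀^Fin 2]→L[ℝ] ℝ}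
      {κ₂' : Type} [Fintype κ₂'] [DecidableEq κ₂'] [Nonempty κ₂'] {E₂' : Type} [NormedAddCommGroup E₂'] [NormedSpace ℂ E₂']
      [FiniteDimensional ℂ E₂'] {Ψ₂' : (κ₂' → ℝ) ≃L[ℝ] E₂'} {η₂' : E₂' [⋀^Fin 2]→L[ℝ] ℝ},
      IsRiemannForm Ψ₁' η₁' → finrank ℂ E₁' = 3 → ∀ hT : IsSimple Ψ₁', IsRiemannForm Ψ₂' η₂' → finrank ℂ E₂' = 2 →
      IsSimple Ψ₂' → IsIsogenous Ψ (prodPeriod Ψ₁' Ψ₂') → IsCMField (centerField Ψ₁' hT) →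
      endAlgRat Ψ₂' = ⊥ ∨ ((∀ M ∈ hodgeGroup Ψ₁', ∀ N ∈ hodgeGroup Ψ₁', M * N = N * M) ∧
        ¬ ∀ M ∈ hodgeGroup Ψ₂', ∀ N ∈ hodgeGroup Ψ₂', M * N = N * M) ∨
        (finrank ℚ (centerField Ψ₁' hT) = 2 ∧ ∀ M ∈ hodgeGroup Ψ₂', ∀ N ∈ hodgeGroup Ψ₂', M * N = N * M)) :
    ∀ k p, divisorClasses (powPeriod Ψ k) p = hodgeClasses (powPeriod Ψ k) p := by
  obtain ⟨V, hV, hVc, hW, hWc, h0V, h0W, hiso⟩ := hη.exists_isIsogenous_prod_of_not_isSimple Ψ hX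
  have hcard := hiso.card_eq
  rw [Fintype.card_sum, Fintype.card_fin, Fintype.card_fin, card_eq_two_mul_finrank Ψ, h5] at hcard
  have hVd := subRank_eq_two_mul_finrank Ψ hV hVc
  have hWd := subRank_eq_two_mul_finrank Ψ hW hWc
  have hA := isRiemannForm_restrict Ψ hη hV hVc
  have hB := isRiemannForm_restrict Ψ hη hW hWc
  have hiso' : IsIsogenous Ψ (prodPeriod (subtorusPeriod Ψ (orthSubspace Ψ η V) hW hWc) (subtorusPeriod Ψ V hV hVc)) :=
    IsIsogenous.trans _ _ _ hiso
      (isIsomorphic_prodPeriod_comm (subtorusPeriod Ψ V hV hVc) (subtorusPeriod Ψ (orthSubspace Ψ η V) hW hWc)).isIsogenous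
  have hcases : (finrank ℂ (cxSpan Ψ V) = 4 ∧ finrank ℂ (cxSpan Ψ (orthSubspace Ψ η V)) = 1) ∨
      (finrank ℂ (cxSpan Ψ V) = 1 ∧ finrank ℂ (cxSpan Ψ (orthSubspace Ψ η V)) = 4) ∨
      (finrank ℂ (cxSpan Ψ V) = 3 ∧ finrank ℂ (cxSpan Ψ (orthSubspace Ψ η V)) = 2) ∨
      (finrank ℂ (cxSpan Ψ V) = 2 ∧ finrank ℂ (cxSpan Ψ (orthSubspace Ψ η V)) = 3) := by omega
  rcases hcases with ⟨ha, hb⟩ | ⟨ha, hb⟩ | ⟨ha, hb⟩ | ⟨ha, hb⟩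
  · exact hiso.forall_divisorClasses_powPeriod_eq_hodgeClasses_of_prod_of_finrank_eq_four_one hA ha hb h4 hef
  · exact hiso'.forall_divisorClasses_powPeriod_eq_hodgeClasses_of_prod_of_finrank_eq_four_one hB hb ha h4 hef
  · exact hiso.forall_divisorClasses_powPeriod_eq_hodgeClasses_of_prod_of_finrank_eq_three_two_of_forall_of_isCMField_imp hA hB
      ha hb hef hTS
  · exact hiso'.forall_divisorClasses_powPeriod_eq_hodgeClasses_of_prod_of_finrank_eq_three_two_of_forall_of_isCMField_imp hB hA
      hb ha hef hTS

/-- **… AND `Hg(X) = Sp_D(V,φ)`** (real points), from (D) by Gordon's Thm. 7.5 (1) ⟹ (2).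
[cite: MoonenZarhin1999LowDim, Thm. (0.2) (4) (p0002 L5–L8)] [cite: Gordon1999HodgeAVSurvey, Thm. 7.5 (1) ⟺ (2)] [cite: Milne1999LefschetzClasses, §4 Prop. 4.8] -/
theorem IsRiemannForm.hodgeGroup_eq_lefschetzGroup_of_not_isSimple_of_finrank_eq_five_of_isCMField_imp
    (hη : IsRiemannForm Ψ η) (h5 : finrank ℂ E = 5) (hX : ¬ IsSimple Ψ)
    (h4 : ∀ {κ' : Type} [Fintype κ'] [DecidableEq κ'] {E' : Type} [NormedAddCommGroup E'] [NormedSpace ℂ E']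
      [FiniteDimensional ℂ E'] {Ψ' : (κ' → ℝ) ≃L[ℝ] E'} {η' : E' [⋀^Fin 2]→L[ℝ] ℝ}, IsRiemannForm Ψ' η' →
      finrank ℂ E' = 4 → IsSimple Ψ' → ∀ {τ : ℂ} (hτ : τ.im ≠ 0), ¬ IsIsogenous Ψ (prodPeriod Ψ' (ellipticPeriod hτ)))
    (hef : ∀ {κ' : Type} [Fintype κ'] [DecidableEq κ'] {E' : Type} [NormedAddCommGroup E'] [NormedSpace ℂ E']
      [FiniteDimensional ℂ E'] {Ψ' : (κ' → ℝ) ≃L[ℝ] E'} {η' : E' [⋀^Fin 2]→L[ℝ] ℝ}, IsRiemannForm Ψ' η' →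
      finrank ℂ E' = 3 → IsSimple Ψ' → ∀ {σ : ℂ} (hσ : σ.im ≠ 0) {ρ : ℂ} (hρ : ρ.im ≠ 0),
      IsIsogenous Ψ (prodPeriod (prodPeriod Ψ' (ellipticPeriod hσ)) (ellipticPeriod hρ)) → ellipticEnd hρ ≠ ⊥ →
      IsEmpty (Algebra.adjoin ℚ {ρ} →ₐ[ℚ] endAlgRat Ψ'))
    (hTS : ∀ {κ₁' : Type} [Fintype κ₁'] [DecidableEq κ₁'] [Nonempty κ₁'] {E₁' : Type} [NormedAddCommGroup E₁']
      [NormedSpace ℂ E₁'] [FiniteDimensional ℂ E₁'] {Ψ₁' : (κ₁' → ℝ) ≃L[ℝ] E₁'} {η₁' : E₁' [⋀^Fin 2]→L[ℝ] ℝ}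
      {κ₂' : Type} [Fintype κ₂'] [DecidableEq κ₂'] [Nonempty κ₂'] {E₂' : Type} [NormedAddCommGroup E₂'] [NormedSpace ℂ E₂']
      [FiniteDimensional ℂ E₂'] {Ψ₂' : (κ₂' → ℝ) ≃L[ℝ] E₂'} {η₂' : E₂' [⋀^Fin 2]→L[ℝ] ℝ},
      IsRiemannForm Ψ₁' η₁' → finrank ℂ E₁' = 3 → ∀ hT : IsSimple Ψ₁', IsRiemannForm Ψ₂' η₂' → finrank ℂ E₂' = 2 →
      IsSimple Ψ₂' → IsIsogenous Ψ (prodPeriod Ψ₁' Ψ₂') → IsCMField (centerField Ψ₁' hT) →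
      endAlgRat Ψ₂' = ⊥ ∨ ((∀ M ∈ hodgeGroup Ψ₁', ∀ N ∈ hodgeGroup Ψ₁', M * N = N * M) ∧
        ¬ ∀ M ∈ hodgeGroup Ψ₂', ∀ N ∈ hodgeGroup Ψ₂', M * N = N * M) ∨
        (finrank ℚ (centerField Ψ₁' hT) = 2 ∧ ∀ M ∈ hodgeGroup Ψ₂', ∀ N ∈ hodgeGroup Ψ₂', M * N = N * M)) :
    hodgeGroup Ψ = lefschetzGroup Ψ η := by
  obtain ⟨G, hG⟩ := hη.exists_ratMatrix_latticeGram
  exact ((hη.forall_divisorClasses_powPeriod_eq_hodgeClasses_iff_eq_and_hodgeGroup_eq_lefschetzGroup hG (by omega)).1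
    (hη.forall_divisorClasses_powPeriod_eq_hodgeClasses_of_not_isSimple_of_finrank_eq_five_of_isCMField_imp h5 hX h4 hef hTS)).2

/-- The `IsAbelianVariety` form of the sharper dimension-5 theorem. [cite: MoonenZarhin1999LowDim, Thm. (0.2) (4) (p0002 L1–L8)] -/
theorem IsAbelianVariety.forall_divisorClasses_powPeriod_eq_hodgeClasses_of_not_isSimple_of_finrank_eq_five_of_isCMField_imp
    (hA : IsAbelianVariety Ψ) (h5 : finrank ℂ E = 5) (hX : ¬ IsSimple Ψ)
    (h4 : ∀ {κ' : Type} [Fintype κ'] [DecidableEq κ'] {E' : Type} [NormedAddCommGroup E'] [NormedSpace ℂ E']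
      [FiniteDimensional ℂ E'] {Ψ' : (κ' → ℝ) ≃L[ℝ] E'} {η' : E' [⋀^Fin 2]→L[ℝ] ℝ}, IsRiemannForm Ψ' η' →
      finrank ℂ E' = 4 → IsSimple Ψ' → ∀ {τ : ℂ} (hτ : τ.im ≠ 0), ¬ IsIsogenous Ψ (prodPeriod Ψ' (ellipticPeriod hτ)))
    (hef : ∀ {κ' : Type} [Fintype κ'] [DecidableEq κ'] {E' : Type} [NormedAddCommGroup E'] [NormedSpace ℂ E']
      [FiniteDimensional ℂ E'] {Ψ' : (κ' → ℝ) ≃L[ℝ] E'} {η' : E' [⋀^Fin 2]→L[ℝ] ℝ}, IsRiemannForm Ψ' η' →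
      finrank ℂ E' = 3 → IsSimple Ψ' → ∀ {σ : ℂ} (hσ : σ.im ≠ 0) {ρ : ℂ} (hρ : ρ.im ≠ 0),
      IsIsogenous Ψ (prodPeriod (prodPeriod Ψ' (ellipticPeriod hσ)) (ellipticPeriod hρ)) → ellipticEnd hρ ≠ ⊥ →
      IsEmpty (Algebra.adjoin ℚ {ρ} →ₐ[ℚ] endAlgRat Ψ'))
    (hTS : ∀ {κ₁' : Type} [Fintype κ₁'] [DecidableEq κ₁'] [Nonempty κ₁'] {E₁' : Type} [NormedAddCommGroup E₁']
      [NormedSpace ℂ E₁'] [FiniteDimensional ℂ E₁'] {Ψ₁' : (κ₁' → ℝ) ≃L[ℝ] E₁'} {η₁' : E₁' [⋀^Fin 2]→L[ℝ] ℝ}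
      {κ₂' : Type} [Fintype κ₂'] [DecidableEq κ₂'] [Nonempty κ₂'] {E₂' : Type} [NormedAddCommGroup E₂'] [NormedSpace ℂ E₂']
      [FiniteDimensional ℂ E₂'] {Ψ₂' : (κ₂' → ℝ) ≃L[ℝ] E₂'} {η₂' : E₂' [⋀^Fin 2]→L[ℝ] ℝ},
      IsRiemannForm Ψ₁' η₁' → finrank ℂ E₁' = 3 → ∀ hT : IsSimple Ψ₁', IsRiemannForm Ψ₂' η₂' → finrank ℂ E₂' = 2 →
      IsSimple Ψ₂' → IsIsogenous Ψ (prodPeriod Ψ₁' Ψ₂') → IsCMField (centerField Ψ₁' hT) →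
      endAlgRat Ψ₂' = ⊥ ∨ ((∀ M ∈ hodgeGroup Ψ₁', ∀ N ∈ hodgeGroup Ψ₁', M * N = N * M) ∧
        ¬ ∀ M ∈ hodgeGroup Ψ₂', ∀ N ∈ hodgeGroup Ψ₂', M * N = N * M) ∨
        (finrank ℚ (centerField Ψ₁' hT) = 2 ∧ ∀ M ∈ hodgeGroup Ψ₂', ∀ N ∈ hodgeGroup Ψ₂', M * N = N * M)) :
    ∀ k p, divisorClasses (powPeriod Ψ k) p = hodgeClasses (powPeriod Ψ k) p := by
  obtain ⟨η, hη⟩ := hA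
  exact hη.forall_divisorClasses_powPeriod_eq_hodgeClasses_of_not_isSimple_of_finrank_eq_five_of_isCMField_imp h5 hX h4 hef hTS

end FivefoldSharper

section FivefoldSharperIsogenous

variable {ι : Type*} [Fintype ι] [DecidableEq ι] {F : Type*} [NormedAddCommGroup F] [NormedSpace ℂ F]
  {Φ : (ι → ℝ) ≃L[ℝ] F}
  {κ : Type} [Fintype κ] [DecidableEq κ] {E : Type} [NormedAddCommGroup E] [NormedSpace ℂ E] [FiniteDimensional ℂ E]
  {Ψ : (κ → ℝ) ≃L[ℝ] E} {η : E [⋀^Fin 2]→L[ℝ] ℝ}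

/-- **Every complex torus isogenous to such a fivefold satisfies (D)** (sharper residual).
[cite: MoonenZarhin1999LowDim, Thm. (0.2) (4) (p0002 L1–L8)] [cite: Lange2023AbelianVarietiesComplex, §1.1.2 Cor. 1.1.16] -/
theorem IsIsogenous.forall_divisorClasses_powPeriod_eq_hodgeClasses_of_not_isSimple_of_finrank_eq_five_of_isCMField_imp
    (hΦ : IsIsogenous Φ Ψ) (hη : IsRiemannForm Ψ η) (h5 : finrank ℂ E = 5) (hX : ¬ IsSimple Ψ)
    (h4 : ∀ {κ' : Type} [Fintype κ'] [DecidableEq κ'] {E' : Type} [NormedAddCommGroup E'] [NormedSpace ℂ E']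
      [FiniteDimensional ℂ E'] {Ψ' : (κ' → ℝ) ≃L[ℝ] E'} {η' : E' [⋀^Fin 2]→L[ℝ] ℝ}, IsRiemannForm Ψ' η' →
      finrank ℂ E' = 4 → IsSimple Ψ' → ∀ {τ : ℂ} (hτ : τ.im ≠ 0), ¬ IsIsogenous Ψ (prodPeriod Ψ' (ellipticPeriod hτ)))
    (hef : ∀ {κ' : Type} [Fintype κ'] [DecidableEq κ'] {E' : Type} [NormedAddCommGroup E'] [NormedSpace ℂ E']
      [FiniteDimensional ℂ E'] {Ψ' : (κ' → ℝ) ≃L[ℝ] E'} {η' : E' [⋀^Fin 2]→L[ℝ] ℝ}, IsRiemannForm Ψ' η' →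
      finrank ℂ E' = 3 → IsSimple Ψ' → ∀ {σ : ℂ} (hσ : σ.im ≠ 0) {ρ : ℂ} (hρ : ρ.im ≠ 0),
      IsIsogenous Ψ (prodPeriod (prodPeriod Ψ' (ellipticPeriod hσ)) (ellipticPeriod hρ)) → ellipticEnd hρ ≠ ⊥ →
      IsEmpty (Algebra.adjoin ℚ {ρ} →ₐ[ℚ] endAlgRat Ψ'))
    (hTS : ∀ {κ₁' : Type} [Fintype κ₁'] [DecidableEq κ₁'] [Nonempty κ₁'] {E₁' : Type} [NormedAddCommGroup E₁']
      [NormedSpace ℂ E₁'] [FiniteDimensional ℂ E₁'] {Ψ₁' : (κ₁' → ℝ) ≃L[ℝ] E₁'} {η₁' : E₁' [⋀^Fin 2]→L[ℝ] ℝ}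
      {κ₂' : Type} [Fintype κ₂'] [DecidableEq κ₂'] [Nonempty κ₂'] {E₂' : Type} [NormedAddCommGroup E₂'] [NormedSpace ℂ E₂']
      [FiniteDimensional ℂ E₂'] {Ψ₂' : (κ₂' → ℝ) ≃L[ℝ] E₂'} {η₂' : E₂' [⋀^Fin 2]→L[ℝ] ℝ},
      IsRiemannForm Ψ₁' η₁' → finrank ℂ E₁' = 3 → ∀ hT : IsSimple Ψ₁', IsRiemannForm Ψ₂' η₂' → finrank ℂ E₂' = 2 →
      IsSimple Ψ₂' → IsIsogenous Ψ (prodPeriod Ψ₁' Ψ₂') → IsCMField (centerField Ψ₁' hT) →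
      endAlgRat Ψ₂' = ⊥ ∨ ((∀ M ∈ hodgeGroup Ψ₁', ∀ N ∈ hodgeGroup Ψ₁', M * N = N * M) ∧
        ¬ ∀ M ∈ hodgeGroup Ψ₂', ∀ N ∈ hodgeGroup Ψ₂', M * N = N * M) ∨
        (finrank ℚ (centerField Ψ₁' hT) = 2 ∧ ∀ M ∈ hodgeGroup Ψ₂', ∀ N ∈ hodgeGroup Ψ₂', M * N = N * M)) :
    ∀ k p, divisorClasses (powPeriod Φ k) p = hodgeClasses (powPeriod Φ k) p :=
  hΦ.forall_powPeriod_divisorClasses_eq_hodgeClasses_iff.2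
    (hη.forall_divisorClasses_powPeriod_eq_hodgeClasses_of_not_isSimple_of_finrank_eq_five_of_isCMField_imp h5 hX h4 hef hTS)

end FivefoldSharperIsogenous

/-! ## §4 The last residual (g55-#9): `T` of type IV(1,1) × `S` of type I(2) ∕ II(1) is covered; only `T` CM × `S` CM remains -/

section ShapesLast

variable {ι : Type} [Fintype ι] [DecidableEq ι] {F : Type} [NormedAddCommGroup F] [NormedSpace ℂ F] {Φ : (ι → ℝ) ≃L[ℝ] F}
  {κ₁ κ₂ : Type} [Fintype κ₁] [DecidableEq κ₁] [Fintype κ₂] [DecidableEq κ₂]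
  {E₁ E₂ : Type} [NormedAddCommGroup E₁] [NormedSpace ℂ E₁] [FiniteDimensional ℂ E₁] [NormedAddCommGroup E₂]
  [NormedSpace ℂ E₂] [FiniteDimensional ℂ E₂] {Ψ₁ : (κ₁ → ℝ) ≃L[ℝ] E₁} {Ψ₂ : (κ₂ → ℝ) ≃L[ℝ] E₂}
  {η₁ : E₁ [⋀^Fin 2]→L[ℝ] ℝ} {η₂ : E₂ [⋀^Fin 2]→L[ℝ] ℝ}

/-- **SHAPE `(3,2)` WITH THE LAST RESIDUAL**: `X ∼ T × S` polarised of dimensions `3`, `2` (simple or not), outside (e) ∕ (f),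
and — when both are simple — `T`, `S` not both of CM type ⟹ `X` satisfies (D).  As §1 ∕ §3, the simple × simple case by g55-#8's
dispatch `IsSimple.forall_divisorClasses_powPeriod_prod_eq_hodgeClasses_of_finrank_eq_three_two_of_not_and`.
[cite: MoonenZarhin1999LowDim, Thm. (0.2) (4) (p0002 L1–L8), §5 (5.6)–(5.8), (5.10)–(5.11) (p0009 L122 – p0011 L5), §3 Lemma (3.4), (3.6)] [cite: Lange2023AbelianVarietiesComplex, §2.4.4 Thm. 2.4.25 and §1.1.2 Cor. 1.1.16] -/
theorem IsIsogenous.forall_divisorClasses_powPeriod_eq_hodgeClasses_of_prod_of_finrank_eq_three_two_of_forall_of_not_and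
    (hiso : IsIsogenous Φ (prodPeriod Ψ₁ Ψ₂)) (hη₁ : IsRiemannForm Ψ₁ η₁) (hη₂ : IsRiemannForm Ψ₂ η₂) (h3₁ : finrank ℂ E₁ = 3)
    (h2₂ : finrank ℂ E₂ = 2)
    (hef : ∀ {κ' : Type} [Fintype κ'] [DecidableEq κ'] {E' : Type} [NormedAddCommGroup E'] [NormedSpace ℂ E']
      [FiniteDimensional ℂ E'] {Ψ' : (κ' → ℝ) ≃L[ℝ] E'} {η' : E' [⋀^Fin 2]→L[ℝ] ℝ}, IsRiemannForm Ψ' η' →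
      finrank ℂ E' = 3 → IsSimple Ψ' → ∀ {σ : ℂ} (hσ : σ.im ≠ 0) {ρ : ℂ} (hρ : ρ.im ≠ 0),
      IsIsogenous Φ (prodPeriod (prodPeriod Ψ' (ellipticPeriod hσ)) (ellipticPeriod hρ)) → ellipticEnd hρ ≠ ⊥ →
      IsEmpty (Algebra.adjoin ℚ {ρ} →ₐ[ℚ] endAlgRat Ψ'))
    (hCM : ∀ {κ₁' : Type} [Fintype κ₁'] [DecidableEq κ₁'] [Nonempty κ₁'] {E₁' : Type} [NormedAddCommGroup E₁']
      [NormedSpace ℂ E₁'] [FiniteDimensional ℂ E₁'] {Ψ₁' : (κ₁' → ℝ) ≃L[ℝ] E₁'} {η₁' : E₁' [⋀^Fin 2]→L[ℝ] ℝ}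
      {κ₂' : Type} [Fintype κ₂'] [DecidableEq κ₂'] [Nonempty κ₂'] {E₂' : Type} [NormedAddCommGroup E₂'] [NormedSpace ℂ E₂']
      [FiniteDimensional ℂ E₂'] {Ψ₂' : (κ₂' → ℝ) ≃L[ℝ] E₂'} {η₂' : E₂' [⋀^Fin 2]→L[ℝ] ℝ},
      IsRiemannForm Ψ₁' η₁' → finrank ℂ E₁' = 3 → IsSimple Ψ₁' → IsRiemannForm Ψ₂' η₂' → finrank ℂ E₂' = 2 →
      IsSimple Ψ₂' → IsIsogenous Φ (prodPeriod Ψ₁' Ψ₂') →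
      ¬ ((∀ M ∈ hodgeGroup Ψ₁', ∀ N ∈ hodgeGroup Ψ₁', M * N = N * M) ∧
        ∀ M ∈ hodgeGroup Ψ₂', ∀ N ∈ hodgeGroup Ψ₂', M * N = N * M)) :
    ∀ k p, divisorClasses (powPeriod Φ k) p = hodgeClasses (powPeriod Φ k) p := by
  haveI : Nonempty κ₁ := Fintype.card_pos_iff.1 (by rw [card_eq_two_mul_finrank Ψ₁, h3₁]; norm_num)
  haveI : Nonempty κ₂ := Fintype.card_pos_iff.1 (by rw [card_eq_two_mul_finrank Ψ₂, h2₂]; norm_num)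
  by_cases hS : IsSimple Ψ₂
  swap
  · -- `S ∼ E_a × E_b`: `X ∼ T × (E_a × E_b) ≅ (T × E_a) × E_b`
    obtain ⟨V, hV, hVc, hW, hWc, hrV, hrW, hSiso, -⟩ := hη₂.exists_isIsogenous_prod_elliptic_of_not_isSimple h2₂ hS
    have hdV : finrank ℂ (cxSpan Ψ₂ V) = 1 := by
      have h := subRank_eq_two_mul_finrank Ψ₂ hV hVc
      omega
    have hdW : finrank ℂ (cxSpan Ψ₂ (orthSubspace Ψ₂ η₂ V)) = 1 := by
      have h := subRank_eq_two_mul_finrank Ψ₂ hW hWc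
      omega
    obtain ⟨a, ha, ea⟩ := exists_isIsomorphic_ellipticPeriod (subtorusPeriod Ψ₂ V hV hVc) hdV
    obtain ⟨b, hb, eb⟩ := exists_isIsomorphic_ellipticPeriod (subtorusPeriod Ψ₂ (orthSubspace Ψ₂ η₂ V) hW hWc) hdW
    have hSab : IsIsogenous Ψ₂ (prodPeriod (ellipticPeriod ha) (ellipticPeriod hb)) :=
      IsIsogenous.trans _ _ _ hSiso (ea.prod eb).isIsogenous
    have hX : IsIsogenous Φ (prodPeriod (prodPeriod Ψ₁ (ellipticPeriod ha)) (ellipticPeriod hb)) :=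
      IsIsogenous.trans _ _ _ (IsIsogenous.trans _ _ _ hiso ((IsIsogenous.refl Ψ₁).prod hSab))
        (isIsomorphic_prodPeriod_assoc Ψ₁ (ellipticPeriod ha) (ellipticPeriod hb)).symm.isIsogenous
    have hX' : IsIsogenous Φ (prodPeriod (prodPeriod Ψ₁ (ellipticPeriod hb)) (ellipticPeriod ha)) :=
      IsIsogenous.trans _ _ _ hX (isIsomorphic_prod_prod_swap₅₈ Ψ₁ (ellipticPeriod ha) (ellipticPeriod hb)).isIsogenous
    exact hX.forall_divisorClasses_powPeriod_eq_hodgeClasses_of_prod_ellipticPeriod_prod_ellipticPeriod_of_finrank_eq_three_of_forall_isEmpty_algHom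
      ha hb hη₁ h3₁ fun hT ↦ ⟨fun hE ↦ hef hη₁ h3₁ hT hb ha hX' hE, fun hE ↦ hef hη₁ h3₁ hT ha hb hX hE⟩
  by_cases hT : IsSimple Ψ₁
  swap
  · -- `T ∼ S' × E_c`: `X ∼ (S' × E_c) × S ≅ (S' × S) × E_c`
    obtain ⟨V, hV, hVc, c, hc, h2', hTiso⟩ :=
      hη₁.exists_isIsogenous_subtorusPeriod_prod_ellipticPeriod_of_not_isSimple_of_finrank_eq_three h3₁ hT
    have hX : IsIsogenous Φ (prodPeriod (prodPeriod (subtorusPeriod Ψ₁ V hV hVc) Ψ₂) (ellipticPeriod hc)) :=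
      IsIsogenous.trans _ _ _ (IsIsogenous.trans _ _ _ hiso (hTiso.prod (IsIsogenous.refl Ψ₂)))
        (isIsomorphic_prod_prod_swap₅₈ (subtorusPeriod Ψ₁ V hV hVc) (ellipticPeriod hc) Ψ₂).isIsogenous
    exact hX.forall_powPeriod_divisorClasses_eq_hodgeClasses_iff.2
      ((isRiemannForm_restrict Ψ₁ hη₁ hV hVc).forall_divisorClasses_powPeriod_prod_prod_ellipticPeriod_eq_hodgeClasses_of_finrank_eq_two_two
        hc hη₂ h2' h2₂)
  · -- both simple: g55-#8's dispatch with the last residual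
    exact hiso.forall_divisorClasses_powPeriod_eq_hodgeClasses_of_prod_of_finrank_eq_three_two_of_not_and hT hS hη₁ hη₂ h3₁ h2₂
      (hCM hη₁ h3₁ hT hη₂ h2₂ hS hiso)

end ShapesLast

section FivefoldLast

variable {κ : Type} [Fintype κ] [DecidableEq κ] {E : Type} [NormedAddCommGroup E] [NormedSpace ℂ E]
  [FiniteDimensional ℂ E] {Ψ : (κ → ℝ) ≃L[ℝ] E} {η : E [⋀^Fin 2]→L[ℝ] ℝ}

/-- **MOONEN–ZARHIN THM. (0.2) (4) FOR NON-SIMPLE FIVEFOLDS, DECOMPOSITION-FREE, WITH THE LAST RESIDUAL**: a polarised non-simple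
abelian fivefold without a simple fourfold isogeny factor (`h4`), outside (e) ∕ (f) (`hef`), and whose decompositions `X ∼ T × S`
into a simple threefold and a simple surface are NOT BOTH OF CM TYPE (`hCM`) satisfies (D): `ℬ•(Xⁿ) = 𝒟•(Xⁿ)` for all `n`.
The only class NOT covered (-- TODO(general form)): `T` CM × `S` CM ((5.10) with `Y₁`, `Y₂` of CM type).
[cite: MoonenZarhin1999LowDim, Thm. (0.2) (4) (p0002 L1–L8), cases (a), (e)–(g) (p0001 L77–L80, L127–L140), §5 (5.6)–(5.12) (p0009 L110 – p0011 L12), §3 Lemma (3.4), (3.6), §4 (4.1)–(4.2)]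
[cite: Lange2023AbelianVarietiesComplex, §2.4.4 Thm. 2.4.25] [cite: SwinnertonDyer1974AbelianVarieties, Ch. II §7 Cor. 3] -/
theorem IsRiemannForm.forall_divisorClasses_powPeriod_eq_hodgeClasses_of_not_isSimple_of_finrank_eq_five_of_not_and
    (hη : IsRiemannForm Ψ η) (h5 : finrank ℂ E = 5) (hX : ¬ IsSimple Ψ)
    (h4 : ∀ {κ' : Type} [Fintype κ'] [DecidableEq κ'] {E' : Type} [NormedAddCommGroup E'] [NormedSpace ℂ E']
      [FiniteDimensional ℂ E'] {Ψ' : (κ' → ℝ) ≃L[ℝ] E'} {η' : E' [⋀^Fin 2]→L[ℝ] ℝ}, IsRiemannForm Ψ' η' →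
      finrank ℂ E' = 4 → IsSimple Ψ' → ∀ {τ : ℂ} (hτ : τ.im ≠ 0), ¬ IsIsogenous Ψ (prodPeriod Ψ' (ellipticPeriod hτ)))
    (hef : ∀ {κ' : Type} [Fintype κ'] [DecidableEq κ'] {E' : Type} [NormedAddCommGroup E'] [NormedSpace ℂ E']
      [FiniteDimensional ℂ E'] {Ψ' : (κ' → ℝ) ≃L[ℝ] E'} {η' : E' [⋀^Fin 2]→L[ℝ] ℝ}, IsRiemannForm Ψ' η' →
      finrank ℂ E' = 3 → IsSimple Ψ' → ∀ {σ : ℂ} (hσ : σ.im ≠ 0) {ρ : ℂ} (hρ : ρ.im ≠ 0),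
      IsIsogenous Ψ (prodPeriod (prodPeriod Ψ' (ellipticPeriod hσ)) (ellipticPeriod hρ)) → ellipticEnd hρ ≠ ⊥ →
      IsEmpty (Algebra.adjoin ℚ {ρ} →ₐ[ℚ] endAlgRat Ψ'))
    (hCM : ∀ {κ₁' : Type} [Fintype κ₁'] [DecidableEq κ₁'] [Nonempty κ₁'] {E₁' : Type} [NormedAddCommGroup E₁']
      [NormedSpace ℂ E₁'] [FiniteDimensional ℂ E₁'] {Ψ₁' : (κ₁' → ℝ) ≃L[ℝ] E₁'} {η₁' : E₁' [⋀^Fin 2]→L[ℝ] ℝ}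
      {κ₂' : Type} [Fintype κ₂'] [DecidableEq κ₂'] [Nonempty κ₂'] {E₂' : Type} [NormedAddCommGroup E₂'] [NormedSpace ℂ E₂']
      [FiniteDimensional ℂ E₂'] {Ψ₂' : (κ₂' → ℝ) ≃L[ℝ] E₂'} {η₂' : E₂' [⋀^Fin 2]→L[ℝ] ℝ},
      IsRiemannForm Ψ₁' η₁' → finrank ℂ E₁' = 3 → IsSimple Ψ₁' → IsRiemannForm Ψ₂' η₂' → finrank ℂ E₂' = 2 →
      IsSimple Ψ₂' → IsIsogenous Ψ (prodPeriod Ψ₁' Ψ₂') →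
      ¬ ((∀ M ∈ hodgeGroup Ψ₁', ∀ N ∈ hodgeGroup Ψ₁', M * N = N * M) ∧
        ∀ M ∈ hodgeGroup Ψ₂', ∀ N ∈ hodgeGroup Ψ₂', M * N = N * M)) :
    ∀ k p, divisorClasses (powPeriod Ψ k) p = hodgeClasses (powPeriod Ψ k) p := by
  obtain ⟨V, hV, hVc, hW, hWc, h0V, h0W, hiso⟩ := hη.exists_isIsogenous_prod_of_not_isSimple Ψ hX
  have hcard := hiso.card_eq
  rw [Fintype.card_sum, Fintype.card_fin, Fintype.card_fin, card_eq_two_mul_finrank Ψ, h5] at hcard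
  have hVd := subRank_eq_two_mul_finrank Ψ hV hVc
  have hWd := subRank_eq_two_mul_finrank Ψ hW hWc
  have hA := isRiemannForm_restrict Ψ hη hV hVc
  have hB := isRiemannForm_restrict Ψ hη hW hWc
  have hiso' : IsIsogenous Ψ (prodPeriod (subtorusPeriod Ψ (orthSubspace Ψ η V) hW hWc) (subtorusPeriod Ψ V hV hVc)) :=
    IsIsogenous.trans _ _ _ hiso
      (isIsomorphic_prodPeriod_comm (subtorusPeriod Ψ V hV hVc) (subtorusPeriod Ψ (orthSubspace Ψ η V) hW hWc)).isIsogenous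
  have hcases : (finrank ℂ (cxSpan Ψ V) = 4 ∧ finrank ℂ (cxSpan Ψ (orthSubspace Ψ η V)) = 1) ∨
      (finrank ℂ (cxSpan Ψ V) = 1 ∧ finrank ℂ (cxSpan Ψ (orthSubspace Ψ η V)) = 4) ∨
      (finrank ℂ (cxSpan Ψ V) = 3 ∧ finrank ℂ (cxSpan Ψ (orthSubspace Ψ η V)) = 2) ∨
      (finrank ℂ (cxSpan Ψ V) = 2 ∧ finrank ℂ (cxSpan Ψ (orthSubspace Ψ η V)) = 3) := by omega
  rcases hcases with ⟨ha, hb⟩ | ⟨ha, hb⟩ | ⟨ha, hb⟩ | ⟨ha, hb⟩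
  · exact hiso.forall_divisorClasses_powPeriod_eq_hodgeClasses_of_prod_of_finrank_eq_four_one hA ha hb h4 hef
  · exact hiso'.forall_divisorClasses_powPeriod_eq_hodgeClasses_of_prod_of_finrank_eq_four_one hB hb ha h4 hef
  · exact hiso.forall_divisorClasses_powPeriod_eq_hodgeClasses_of_prod_of_finrank_eq_three_two_of_forall_of_not_and hA hB ha hb
      hef hCM
  · exact hiso'.forall_divisorClasses_powPeriod_eq_hodgeClasses_of_prod_of_finrank_eq_three_two_of_forall_of_not_and hB hA hb ha
      hef hCM

/-- **… AND `Hg(X) = Sp_D(V,φ)`** (real points), from (D) by Gordon's Thm. 7.5 (1) ⟹ (2).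
[cite: MoonenZarhin1999LowDim, Thm. (0.2) (4) (p0002 L5–L8)] [cite: Gordon1999HodgeAVSurvey, Thm. 7.5 (1) ⟺ (2)] [cite: Milne1999LefschetzClasses, §4 Prop. 4.8] -/
theorem IsRiemannForm.hodgeGroup_eq_lefschetzGroup_of_not_isSimple_of_finrank_eq_five_of_not_and
    (hη : IsRiemannForm Ψ η) (h5 : finrank ℂ E = 5) (hX : ¬ IsSimple Ψ)
    (h4 : ∀ {κ' : Type} [Fintype κ'] [DecidableEq κ'] {E' : Type} [NormedAddCommGroup E'] [NormedSpace ℂ E']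
      [FiniteDimensional ℂ E'] {Ψ' : (κ' → ℝ) ≃L[ℝ] E'} {η' : E' [⋀^Fin 2]→L[ℝ] ℝ}, IsRiemannForm Ψ' η' →
      finrank ℂ E' = 4 → IsSimple Ψ' → ∀ {τ : ℂ} (hτ : τ.im ≠ 0), ¬ IsIsogenous Ψ (prodPeriod Ψ' (ellipticPeriod hτ)))
    (hef : ∀ {κ' : Type} [Fintype κ'] [DecidableEq κ'] {E' : Type} [NormedAddCommGroup E'] [NormedSpace ℂ E']
      [FiniteDimensional ℂ E'] {Ψ' : (κ' → ℝ) ≃L[ℝ] E'} {η' : E' [⋀^Fin 2]→L[ℝ] ℝ}, IsRiemannForm Ψ' η' →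
      finrank ℂ E' = 3 → IsSimple Ψ' → ∀ {σ : ℂ} (hσ : σ.im ≠ 0) {ρ : ℂ} (hρ : ρ.im ≠ 0),
      IsIsogenous Ψ (prodPeriod (prodPeriod Ψ' (ellipticPeriod hσ)) (ellipticPeriod hρ)) → ellipticEnd hρ ≠ ⊥ →
      IsEmpty (Algebra.adjoin ℚ {ρ} →ₐ[ℚ] endAlgRat Ψ'))
    (hCM : ∀ {κ₁' : Type} [Fintype κ₁'] [DecidableEq κ₁'] [Nonempty κ₁'] {E₁' : Type} [NormedAddCommGroup E₁']
      [NormedSpace ℂ E₁'] [FiniteDimensional ℂ E₁'] {Ψ₁' : (κ₁' → ℝ) ≃L[ℝ] E₁'} {η₁' : E₁' [⋀^Fin 2]→L[ℝ] ℝ}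
      {κ₂' : Type} [Fintype κ₂'] [DecidableEq κ₂'] [Nonempty κ₂'] {E₂' : Type} [NormedAddCommGroup E₂'] [NormedSpace ℂ E₂']
      [FiniteDimensional ℂ E₂'] {Ψ₂' : (κ₂' → ℝ) ≃L[ℝ] E₂'} {η₂' : E₂' [⋀^Fin 2]→L[ℝ] ℝ},
      IsRiemannForm Ψ₁' η₁' → finrank ℂ E₁' = 3 → IsSimple Ψ₁' → IsRiemannForm Ψ₂' η₂' → finrank ℂ E₂' = 2 →
      IsSimple Ψ₂' → IsIsogenous Ψ (prodPeriod Ψ₁' Ψ₂') →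
      ¬ ((∀ M ∈ hodgeGroup Ψ₁', ∀ N ∈ hodgeGroup Ψ₁', M * N = N * M) ∧
        ∀ M ∈ hodgeGroup Ψ₂', ∀ N ∈ hodgeGroup Ψ₂', M * N = N * M)) :
    hodgeGroup Ψ = lefschetzGroup Ψ η := by
  obtain ⟨G, hG⟩ := hη.exists_ratMatrix_latticeGram
  exact ((hη.forall_divisorClasses_powPeriod_eq_hodgeClasses_iff_eq_and_hodgeGroup_eq_lefschetzGroup hG (by omega)).1
    (hη.forall_divisorClasses_powPeriod_eq_hodgeClasses_of_not_isSimple_of_finrank_eq_five_of_not_and h5 hX h4 hef hCM)).2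

/-- The `IsAbelianVariety` form of the dimension-5 theorem with the last residual. [cite: MoonenZarhin1999LowDim, Thm. (0.2) (4) (p0002 L1–L8)] -/
theorem IsAbelianVariety.forall_divisorClasses_powPeriod_eq_hodgeClasses_of_not_isSimple_of_finrank_eq_five_of_not_and
    (hA : IsAbelianVariety Ψ) (h5 : finrank ℂ E = 5) (hX : ¬ IsSimple Ψ)
    (h4 : ∀ {κ' : Type} [Fintype κ'] [DecidableEq κ'] {E' : Type} [NormedAddCommGroup E'] [NormedSpace ℂ E']
      [FiniteDimensional ℂ E'] {Ψ' : (κ' → ℝ) ≃L[ℝ] E'} {η' : E' [⋀^Fin 2]→L[ℝ] ℝ}, IsRiemannForm Ψ' η' →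
      finrank ℂ E' = 4 → IsSimple Ψ' → ∀ {τ : ℂ} (hτ : τ.im ≠ 0), ¬ IsIsogenous Ψ (prodPeriod Ψ' (ellipticPeriod hτ)))
    (hef : ∀ {κ' : Type} [Fintype κ'] [DecidableEq κ'] {E' : Type} [NormedAddCommGroup E'] [NormedSpace ℂ E']
      [FiniteDimensional ℂ E'] {Ψ' : (κ' → ℝ) ≃L[ℝ] E'} {η' : E' [⋀^Fin 2]→L[ℝ] ℝ}, IsRiemannForm Ψ' η' →
      finrank ℂ E' = 3 → IsSimple Ψ' → ∀ {σ : ℂ} (hσ : σ.im ≠ 0) {ρ : ℂ} (hρ : ρ.im ≠ 0),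
      IsIsogenous Ψ (prodPeriod (prodPeriod Ψ' (ellipticPeriod hσ)) (ellipticPeriod hρ)) → ellipticEnd hρ ≠ ⊥ →
      IsEmpty (Algebra.adjoin ℚ {ρ} →ₐ[ℚ] endAlgRat Ψ'))
    (hCM : ∀ {κ₁' : Type} [Fintype κ₁'] [DecidableEq κ₁'] [Nonempty κ₁'] {E₁' : Type} [NormedAddCommGroup E₁']
      [NormedSpace ℂ E₁'] [FiniteDimensional ℂ E₁'] {Ψ₁' : (κ₁' → ℝ) ≃L[ℝ] E₁'} {η₁' : E₁' [⋀^Fin 2]→L[ℝ] ℝ}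
      {κ₂' : Type} [Fintype κ₂'] [DecidableEq κ₂'] [Nonempty κ₂'] {E₂' : Type} [NormedAddCommGroup E₂'] [NormedSpace ℂ E₂']
      [FiniteDimensional ℂ E₂'] {Ψ₂' : (κ₂' → ℝ) ≃L[ℝ] E₂'} {η₂' : E₂' [⋀^Fin 2]→L[ℝ] ℝ},
      IsRiemannForm Ψ₁' η₁' → finrank ℂ E₁' = 3 → IsSimple Ψ₁' → IsRiemannForm Ψ₂' η₂' → finrank ℂ E₂' = 2 →
      IsSimple Ψ₂' → IsIsogenous Ψ (prodPeriod Ψ₁' Ψ₂') →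
      ¬ ((∀ M ∈ hodgeGroup Ψ₁', ∀ N ∈ hodgeGroup Ψ₁', M * N = N * M) ∧
        ∀ M ∈ hodgeGroup Ψ₂', ∀ N ∈ hodgeGroup Ψ₂', M * N = N * M)) :
    ∀ k p, divisorClasses (powPeriod Ψ k) p = hodgeClasses (powPeriod Ψ k) p := by
  obtain ⟨η, hη⟩ := hA
  exact hη.forall_divisorClasses_powPeriod_eq_hodgeClasses_of_not_isSimple_of_finrank_eq_five_of_not_and h5 hX h4 hef hCM

end FivefoldLast

section FivefoldLastIsogenous

variable {ι : Type*} [Fintype ι] [DecidableEq ι] {F : Type*} [NormedAddCommGroup F] [NormedSpace ℂ F]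
  {Φ : (ι → ℝ) ≃L[ℝ] F}
  {κ : Type} [Fintype κ] [DecidableEq κ] {E : Type} [NormedAddCommGroup E] [NormedSpace ℂ E] [FiniteDimensional ℂ E]
  {Ψ : (κ → ℝ) ≃L[ℝ] E} {η : E [⋀^Fin 2]→L[ℝ] ℝ}

/-- **Every complex torus isogenous to such a fivefold satisfies (D)** (last residual).
[cite: MoonenZarhin1999LowDim, Thm. (0.2) (4) (p0002 L1–L8)] [cite: Lange2023AbelianVarietiesComplex, §1.1.2 Cor. 1.1.16] -/
theorem IsIsogenous.forall_divisorClasses_powPeriod_eq_hodgeClasses_of_not_isSimple_of_finrank_eq_five_of_not_and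
    (hΦ : IsIsogenous Φ Ψ) (hη : IsRiemannForm Ψ η) (h5 : finrank ℂ E = 5) (hX : ¬ IsSimple Ψ)
    (h4 : ∀ {κ' : Type} [Fintype κ'] [DecidableEq κ'] {E' : Type} [NormedAddCommGroup E'] [NormedSpace ℂ E']
      [FiniteDimensional ℂ E'] {Ψ' : (κ' → ℝ) ≃L[ℝ] E'} {η' : E' [⋀^Fin 2]→L[ℝ] ℝ}, IsRiemannForm Ψ' η' →
      finrank ℂ E' = 4 → IsSimple Ψ' → ∀ {τ : ℂ} (hτ : τ.im ≠ 0), ¬ IsIsogenous Ψ (prodPeriod Ψ' (ellipticPeriod hτ)))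
    (hef : ∀ {κ' : Type} [Fintype κ'] [DecidableEq κ'] {E' : Type} [NormedAddCommGroup E'] [NormedSpace ℂ E']
      [FiniteDimensional ℂ E'] {Ψ' : (κ' → ℝ) ≃L[ℝ] E'} {η' : E' [⋀^Fin 2]→L[ℝ] ℝ}, IsRiemannForm Ψ' η' →
      finrank ℂ E' = 3 → IsSimple Ψ' → ∀ {σ : ℂ} (hσ : σ.im ≠ 0) {ρ : ℂ} (hρ : ρ.im ≠ 0),
      IsIsogenous Ψ (prodPeriod (prodPeriod Ψ' (ellipticPeriod hσ)) (ellipticPeriod hρ)) → ellipticEnd hρ ≠ ⊥ →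
      IsEmpty (Algebra.adjoin ℚ {ρ} →ₐ[ℚ] endAlgRat Ψ'))
    (hCM : ∀ {κ₁' : Type} [Fintype κ₁'] [DecidableEq κ₁'] [Nonempty κ₁'] {E₁' : Type} [NormedAddCommGroup E₁']
      [NormedSpace ℂ E₁'] [FiniteDimensional ℂ E₁'] {Ψ₁' : (κ₁' → ℝ) ≃L[ℝ] E₁'} {η₁' : E₁' [⋀^Fin 2]→L[ℝ] ℝ}
      {κ₂' : Type} [Fintype κ₂'] [DecidableEq κ₂'] [Nonempty κ₂'] {E₂' : Type} [NormedAddCommGroup E₂'] [NormedSpace ℂ E₂']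
      [FiniteDimensional ℂ E₂'] {Ψ₂' : (κ₂' → ℝ) ≃L[ℝ] E₂'} {η₂' : E₂' [⋀^Fin 2]→L[ℝ] ℝ},
      IsRiemannForm Ψ₁' η₁' → finrank ℂ E₁' = 3 → IsSimple Ψ₁' → IsRiemannForm Ψ₂' η₂' → finrank ℂ E₂' = 2 →
      IsSimple Ψ₂' → IsIsogenous Ψ (prodPeriod Ψ₁' Ψ₂') →
      ¬ ((∀ M ∈ hodgeGroup Ψ₁', ∀ N ∈ hodgeGroup Ψ₁', M * N = N * M) ∧
        ∀ M ∈ hodgeGroup Ψ₂', ∀ N ∈ hodgeGroup Ψ₂', M * N = N * M)) :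
    ∀ k p, divisorClasses (powPeriod Φ k) p = hodgeClasses (powPeriod Φ k) p :=
  hΦ.forall_powPeriod_divisorClasses_eq_hodgeClasses_iff.2
    (hη.forall_divisorClasses_powPeriod_eq_hodgeClasses_of_not_isSimple_of_finrank_eq_five_of_not_and h5 hX h4 hef hCM)

end FivefoldLastIsogenous

/-! ## §5 No residual (g55-#13): Moonen–Zarhin Thm. (0.2) (4) for non-simple fivefolds with only `h4`, `hef` -/

section ShapesFinal

variable {ι : Type} [Fintype ι] [DecidableEq ι] {F : Type} [NormedAddCommGroup F] [NormedSpace ℂ F] {Φ : (ι → ℝ) ≃L[ℝ] F}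
  {κ₁ κ₂ : Type} [Fintype κ₁] [DecidableEq κ₁] [Fintype κ₂] [DecidableEq κ₂]
  {E₁ E₂ : Type} [NormedAddCommGroup E₁] [NormedSpace ℂ E₁] [FiniteDimensional ℂ E₁] [NormedAddCommGroup E₂]
  [NormedSpace ℂ E₂] [FiniteDimensional ℂ E₂] {Ψ₁ : (κ₁ → ℝ) ≃L[ℝ] E₁} {Ψ₂ : (κ₂ → ℝ) ≃L[ℝ] E₂}
  {η₁ : E₁ [⋀^Fin 2]→L[ℝ] ℝ} {η₂ : E₂ [⋀^Fin 2]→L[ℝ] ℝ}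

/-- **SHAPE `(3,2)`, NO RESIDUAL**: `X ∼ T × S` polarised of dimensions `3`, `2` (simple or not), outside (e) ∕ (f) ⟹ `X`
satisfies (D).  As §1 ∕ §3 ∕ §4; the simple × simple case by g55-#12's unconditional
`IsSimple.forall_divisorClasses_powPeriod_prod_eq_hodgeClasses_of_isSimple_of_finrank_eq_three_two`.
[cite: MoonenZarhin1999LowDim, Thm. (0.2) (4) (p0002 L1–L8), §5 (5.6)–(5.11) (p0009 L122 – p0011 L5), §3 Lemma (3.4), (3.6), (3.7)] [cite: Lange2023AbelianVarietiesComplex, §2.4.4 Thm. 2.4.25 and §1.1.2 Cor. 1.1.16] -/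
theorem IsIsogenous.forall_divisorClasses_powPeriod_eq_hodgeClasses_of_prod_of_finrank_eq_three_two_of_forall_isEmpty
    (hiso : IsIsogenous Φ (prodPeriod Ψ₁ Ψ₂)) (hη₁ : IsRiemannForm Ψ₁ η₁) (hη₂ : IsRiemannForm Ψ₂ η₂) (h3₁ : finrank ℂ E₁ = 3)
    (h2₂ : finrank ℂ E₂ = 2)
    (hef : ∀ {κ' : Type} [Fintype κ'] [DecidableEq κ'] {E' : Type} [NormedAddCommGroup E'] [NormedSpace ℂ E']
      [FiniteDimensional ℂ E'] {Ψ' : (κ' → ℝ) ≃L[ℝ] E'} {η' : E' [⋀^Fin 2]→L[ℝ] ℝ}, IsRiemannForm Ψ' η' →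
      finrank ℂ E' = 3 → IsSimple Ψ' → ∀ {σ : ℂ} (hσ : σ.im ≠ 0) {ρ : ℂ} (hρ : ρ.im ≠ 0),
      IsIsogenous Φ (prodPeriod (prodPeriod Ψ' (ellipticPeriod hσ)) (ellipticPeriod hρ)) → ellipticEnd hρ ≠ ⊥ →
      IsEmpty (Algebra.adjoin ℚ {ρ} →ₐ[ℚ] endAlgRat Ψ')) :
    ∀ k p, divisorClasses (powPeriod Φ k) p = hodgeClasses (powPeriod Φ k) p := by
  haveI : Nonempty κ₁ := Fintype.card_pos_iff.1 (by rw [card_eq_two_mul_finrank Ψ₁, h3₁]; norm_num)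
  haveI : Nonempty κ₂ := Fintype.card_pos_iff.1 (by rw [card_eq_two_mul_finrank Ψ₂, h2₂]; norm_num)
  by_cases hS : IsSimple Ψ₂
  swap
  · -- `S ∼ E_a × E_b`: `X ∼ T × (E_a × E_b) ≅ (T × E_a) × E_b`
    obtain ⟨V, hV, hVc, hW, hWc, hrV, hrW, hSiso, -⟩ := hη₂.exists_isIsogenous_prod_elliptic_of_not_isSimple h2₂ hS
    have hdV : finrank ℂ (cxSpan Ψ₂ V) = 1 := by
      have h := subRank_eq_two_mul_finrank Ψ₂ hV hVc
      omega
    have hdW : finrank ℂ (cxSpan Ψ₂ (orthSubspace Ψ₂ η₂ V)) = 1 := by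
      have h := subRank_eq_two_mul_finrank Ψ₂ hW hWc
      omega
    obtain ⟨a, ha, ea⟩ := exists_isIsomorphic_ellipticPeriod (subtorusPeriod Ψ₂ V hV hVc) hdV
    obtain ⟨b, hb, eb⟩ := exists_isIsomorphic_ellipticPeriod (subtorusPeriod Ψ₂ (orthSubspace Ψ₂ η₂ V) hW hWc) hdW
    have hSab : IsIsogenous Ψ₂ (prodPeriod (ellipticPeriod ha) (ellipticPeriod hb)) :=
      IsIsogenous.trans _ _ _ hSiso (ea.prod eb).isIsogenous
    have hX : IsIsogenous Φ (prodPeriod (prodPeriod Ψ₁ (ellipticPeriod ha)) (ellipticPeriod hb)) :=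
      IsIsogenous.trans _ _ _ (IsIsogenous.trans _ _ _ hiso ((IsIsogenous.refl Ψ₁).prod hSab))
        (isIsomorphic_prodPeriod_assoc Ψ₁ (ellipticPeriod ha) (ellipticPeriod hb)).symm.isIsogenous
    have hX' : IsIsogenous Φ (prodPeriod (prodPeriod Ψ₁ (ellipticPeriod hb)) (ellipticPeriod ha)) :=
      IsIsogenous.trans _ _ _ hX (isIsomorphic_prod_prod_swap₅₈ Ψ₁ (ellipticPeriod ha) (ellipticPeriod hb)).isIsogenous
    exact hX.forall_divisorClasses_powPeriod_eq_hodgeClasses_of_prod_ellipticPeriod_prod_ellipticPeriod_of_finrank_eq_three_of_forall_isEmpty_algHom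
      ha hb hη₁ h3₁ fun hT ↦ ⟨fun hE ↦ hef hη₁ h3₁ hT hb ha hX' hE, fun hE ↦ hef hη₁ h3₁ hT ha hb hX hE⟩
  by_cases hT : IsSimple Ψ₁
  swap
  · -- `T ∼ S' × E_c`: `X ∼ (S' × E_c) × S ≅ (S' × S) × E_c`
    obtain ⟨V, hV, hVc, c, hc, h2', hTiso⟩ :=
      hη₁.exists_isIsogenous_subtorusPeriod_prod_ellipticPeriod_of_not_isSimple_of_finrank_eq_three h3₁ hT
    have hX : IsIsogenous Φ (prodPeriod (prodPeriod (subtorusPeriod Ψ₁ V hV hVc) Ψ₂) (ellipticPeriod hc)) :=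
      IsIsogenous.trans _ _ _ (IsIsogenous.trans _ _ _ hiso (hTiso.prod (IsIsogenous.refl Ψ₂)))
        (isIsomorphic_prod_prod_swap₅₈ (subtorusPeriod Ψ₁ V hV hVc) (ellipticPeriod hc) Ψ₂).isIsogenous
    exact hX.forall_powPeriod_divisorClasses_eq_hodgeClasses_iff.2
      ((isRiemannForm_restrict Ψ₁ hη₁ hV hVc).forall_divisorClasses_powPeriod_prod_prod_ellipticPeriod_eq_hodgeClasses_of_finrank_eq_two_two
        hc hη₂ h2' h2₂)
  · -- both simple: g55-#12's unconditional dispatch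
    exact hiso.forall_powPeriod_divisorClasses_eq_hodgeClasses_iff.2
      (hT.forall_divisorClasses_powPeriod_prod_eq_hodgeClasses_of_isSimple_of_finrank_eq_three_two hS hη₁ hη₂ h3₁ h2₂)

end ShapesFinal

section FivefoldFinal

variable {κ : Type} [Fintype κ] [DecidableEq κ] {E : Type} [NormedAddCommGroup E] [NormedSpace ℂ E]
  [FiniteDimensional ℂ E] {Ψ : (κ → ℝ) ≃L[ℝ] E} {η : E [⋀^Fin 2]→L[ℝ] ℝ}

/-- **MOONEN–ZARHIN THM. (0.2) (4) FOR NON-SIMPLE FIVEFOLDS, DECOMPOSITION-FREE, NO RESIDUAL**: a polarised non-simple abelian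
fivefold with no simple abelian fourfold isogeny factor (`h4`) and not of the forms (e) ∕ (f) (`hef`) satisfies (D):
`ℬ•(Xⁿ) = 𝒟•(Xⁿ)` for all `n` («Suppose we are not in one of the cases (e), (f) or (g) […] In particular, if `X` has no simple
factor of dimension 4 then `Hg(X) = Sp_D(V,φ)` and `ℬ•(Xⁿ) = 𝒟•(Xⁿ)` for every `n ≥ 1`»; case (g) has a simple fourfold factor).
The Poincaré splitting of a proper abelian subvariety gives `X ∼ A × B` of shape `(4,1)` ∕ `(1,4)` (§1, ✔ g55-#2: the fourfold
factor is non-simple by `h4`) or `(3,2)` ∕ `(2,3)` (§5's shape theorem: all cases of two simple factors now covered —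
(5.6)–(5.8) by ✔ g55-#3 ∕ #5 ∕ #8, (5.10) `d_min = 2` by ✔ g55-#12 — and the non-simple factors by ✔ g55-#1 ∕ #2).
[cite: MoonenZarhin1999LowDim, Thm. (0.2) (4) (p0002 L1–L8), cases (e)–(g) (p0001 L127–L140), §5 (5.6)–(5.12) (p0009 L110 – p0011 L12), §3 Lemma (3.4), (3.6), (3.7), §4 (4.1)–(4.2)]
[cite: Lange2023AbelianVarietiesComplex, §2.4.4 Thm. 2.4.25] [cite: SwinnertonDyer1974AbelianVarieties, Ch. II §7 Cor. 3] -/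
theorem IsRiemannForm.forall_divisorClasses_powPeriod_eq_hodgeClasses_of_not_isSimple_of_finrank_eq_five_of_forall_not_isIsogenous_of_forall_isEmpty
    (hη : IsRiemannForm Ψ η) (h5 : finrank ℂ E = 5) (hX : ¬ IsSimple Ψ)
    (h4 : ∀ {κ' : Type} [Fintype κ'] [DecidableEq κ'] {E' : Type} [NormedAddCommGroup E'] [NormedSpace ℂ E']
      [FiniteDimensional ℂ E'] {Ψ' : (κ' → ℝ) ≃L[ℝ] E'} {η' : E' [⋀^Fin 2]→L[ℝ] ℝ}, IsRiemannForm Ψ' η' →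
      finrank ℂ E' = 4 → IsSimple Ψ' → ∀ {τ : ℂ} (hτ : τ.im ≠ 0), ¬ IsIsogenous Ψ (prodPeriod Ψ' (ellipticPeriod hτ)))
    (hef : ∀ {κ' : Type} [Fintype κ'] [DecidableEq κ'] {E' : Type} [NormedAddCommGroup E'] [NormedSpace ℂ E']
      [FiniteDimensional ℂ E'] {Ψ' : (κ' → ℝ) ≃L[ℝ] E'} {η' : E' [⋀^Fin 2]→L[ℝ] ℝ}, IsRiemannForm Ψ' η' →
      finrank ℂ E' = 3 → IsSimple Ψ' → ∀ {σ : ℂ} (hσ : σ.im ≠ 0) {ρ : ℂ} (hρ : ρ.im ≠ 0),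
      IsIsogenous Ψ (prodPeriod (prodPeriod Ψ' (ellipticPeriod hσ)) (ellipticPeriod hρ)) → ellipticEnd hρ ≠ ⊥ →
      IsEmpty (Algebra.adjoin ℚ {ρ} →ₐ[ℚ] endAlgRat Ψ')) :
    ∀ k p, divisorClasses (powPeriod Ψ k) p = hodgeClasses (powPeriod Ψ k) p := by
  obtain ⟨V, hV, hVc, hW, hWc, h0V, h0W, hiso⟩ := hη.exists_isIsogenous_prod_of_not_isSimple Ψ hX
  have hcard := hiso.card_eq
  rw [Fintype.card_sum, Fintype.card_fin, Fintype.card_fin, card_eq_two_mul_finrank Ψ, h5] at hcard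
  have hVd := subRank_eq_two_mul_finrank Ψ hV hVc
  have hWd := subRank_eq_two_mul_finrank Ψ hW hWc
  have hA := isRiemannForm_restrict Ψ hη hV hVc
  have hB := isRiemannForm_restrict Ψ hη hW hWc
  have hiso' : IsIsogenous Ψ (prodPeriod (subtorusPeriod Ψ (orthSubspace Ψ η V) hW hWc) (subtorusPeriod Ψ V hV hVc)) :=
    IsIsogenous.trans _ _ _ hiso
      (isIsomorphic_prodPeriod_comm (subtorusPeriod Ψ V hV hVc) (subtorusPeriod Ψ (orthSubspace Ψ η V) hW hWc)).isIsogenous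
  have hcases : (finrank ℂ (cxSpan Ψ V) = 4 ∧ finrank ℂ (cxSpan Ψ (orthSubspace Ψ η V)) = 1) ∨
      (finrank ℂ (cxSpan Ψ V) = 1 ∧ finrank ℂ (cxSpan Ψ (orthSubspace Ψ η V)) = 4) ∨
      (finrank ℂ (cxSpan Ψ V) = 3 ∧ finrank ℂ (cxSpan Ψ (orthSubspace Ψ η V)) = 2) ∨
      (finrank ℂ (cxSpan Ψ V) = 2 ∧ finrank ℂ (cxSpan Ψ (orthSubspace Ψ η V)) = 3) := by omega
  rcases hcases with ⟨ha, hb⟩ | ⟨ha, hb⟩ | ⟨ha, hb⟩ | ⟨ha, hb⟩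
  · exact hiso.forall_divisorClasses_powPeriod_eq_hodgeClasses_of_prod_of_finrank_eq_four_one hA ha hb h4 hef
  · exact hiso'.forall_divisorClasses_powPeriod_eq_hodgeClasses_of_prod_of_finrank_eq_four_one hB hb ha h4 hef
  · exact hiso.forall_divisorClasses_powPeriod_eq_hodgeClasses_of_prod_of_finrank_eq_three_two_of_forall_isEmpty hA hB ha hb hef
  · exact hiso'.forall_divisorClasses_powPeriod_eq_hodgeClasses_of_prod_of_finrank_eq_three_two_of_forall_isEmpty hB hA hb ha hef

/-- **… AND `Hg(X) = Sp_D(V,φ)`** (real points), from (D) by Gordon's Thm. 7.5 (1) ⟹ (2).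
[cite: MoonenZarhin1999LowDim, Thm. (0.2) (4) (p0002 L5–L8)] [cite: Gordon1999HodgeAVSurvey, Thm. 7.5 (1) ⟺ (2)] [cite: Milne1999LefschetzClasses, §4 Prop. 4.8] -/
theorem IsRiemannForm.hodgeGroup_eq_lefschetzGroup_of_not_isSimple_of_finrank_eq_five_of_forall_not_isIsogenous_of_forall_isEmpty
    (hη : IsRiemannForm Ψ η) (h5 : finrank ℂ E = 5) (hX : ¬ IsSimple Ψ)
    (h4 : ∀ {κ' : Type} [Fintype κ'] [DecidableEq κ'] {E' : Type} [NormedAddCommGroup E'] [NormedSpace ℂ E']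
      [FiniteDimensional ℂ E'] {Ψ' : (κ' → ℝ) ≃L[ℝ] E'} {η' : E' [⋀^Fin 2]→L[ℝ] ℝ}, IsRiemannForm Ψ' η' →
      finrank ℂ E' = 4 → IsSimple Ψ' → ∀ {τ : ℂ} (hτ : τ.im ≠ 0), ¬ IsIsogenous Ψ (prodPeriod Ψ' (ellipticPeriod hτ)))
    (hef : ∀ {κ' : Type} [Fintype κ'] [DecidableEq κ'] {E' : Type} [NormedAddCommGroup E'] [NormedSpace ℂ E']
      [FiniteDimensional ℂ E'] {Ψ' : (κ' → ℝ) ≃L[ℝ] E'} {η' : E' [⋀^Fin 2]→L[ℝ] ℝ}, IsRiemannForm Ψ' η' →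
      finrank ℂ E' = 3 → IsSimple Ψ' → ∀ {σ : ℂ} (hσ : σ.im ≠ 0) {ρ : ℂ} (hρ : ρ.im ≠ 0),
      IsIsogenous Ψ (prodPeriod (prodPeriod Ψ' (ellipticPeriod hσ)) (ellipticPeriod hρ)) → ellipticEnd hρ ≠ ⊥ →
      IsEmpty (Algebra.adjoin ℚ {ρ} →ₐ[ℚ] endAlgRat Ψ')) :
    hodgeGroup Ψ = lefschetzGroup Ψ η := by
  obtain ⟨G, hG⟩ := hη.exists_ratMatrix_latticeGram
  exact ((hη.forall_divisorClasses_powPeriod_eq_hodgeClasses_iff_eq_and_hodgeGroup_eq_lefschetzGroup hG (by omega)).1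
    (hη.forall_divisorClasses_powPeriod_eq_hodgeClasses_of_not_isSimple_of_finrank_eq_five_of_forall_not_isIsogenous_of_forall_isEmpty
      h5 hX h4 hef)).2

/-- The `IsAbelianVariety` form of the dimension-5 theorem, no residual. [cite: MoonenZarhin1999LowDim, Thm. (0.2) (4) (p0002 L1–L8)] -/
theorem IsAbelianVariety.forall_divisorClasses_powPeriod_eq_hodgeClasses_of_not_isSimple_of_finrank_eq_five_of_forall_not_isIsogenous_of_forall_isEmpty
    (hA : IsAbelianVariety Ψ) (h5 : finrank ℂ E = 5) (hX : ¬ IsSimple Ψ)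
    (h4 : ∀ {κ' : Type} [Fintype κ'] [DecidableEq κ'] {E' : Type} [NormedAddCommGroup E'] [NormedSpace ℂ E']
      [FiniteDimensional ℂ E'] {Ψ' : (κ' → ℝ) ≃L[ℝ] E'} {η' : E' [⋀^Fin 2]→L[ℝ] ℝ}, IsRiemannForm Ψ' η' →
      finrank ℂ E' = 4 → IsSimple Ψ' → ∀ {τ : ℂ} (hτ : τ.im ≠ 0), ¬ IsIsogenous Ψ (prodPeriod Ψ' (ellipticPeriod hτ)))
    (hef : ∀ {κ' : Type} [Fintype κ'] [DecidableEq κ'] {E' : Type} [NormedAddCommGroup E'] [NormedSpace ℂ E']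
      [FiniteDimensional ℂ E'] {Ψ' : (κ' → ℝ) ≃L[ℝ] E'} {η' : E' [⋀^Fin 2]→L[ℝ] ℝ}, IsRiemannForm Ψ' η' →
      finrank ℂ E' = 3 → IsSimple Ψ' → ∀ {σ : ℂ} (hσ : σ.im ≠ 0) {ρ : ℂ} (hρ : ρ.im ≠ 0),
      IsIsogenous Ψ (prodPeriod (prodPeriod Ψ' (ellipticPeriod hσ)) (ellipticPeriod hρ)) → ellipticEnd hρ ≠ ⊥ →
      IsEmpty (Algebra.adjoin ℚ {ρ} →ₐ[ℚ] endAlgRat Ψ')) :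
    ∀ k p, divisorClasses (powPeriod Ψ k) p = hodgeClasses (powPeriod Ψ k) p := by
  obtain ⟨η, hη⟩ := hA
  exact hη.forall_divisorClasses_powPeriod_eq_hodgeClasses_of_not_isSimple_of_finrank_eq_five_of_forall_not_isIsogenous_of_forall_isEmpty
    h5 hX h4 hef

end FivefoldFinal

section FivefoldFinalIsogenous

variable {ι : Type*} [Fintype ι] [DecidableEq ι] {F : Type*} [NormedAddCommGroup F] [NormedSpace ℂ F]
  {Φ : (ι → ℝ) ≃L[ℝ] F}
  {κ : Type} [Fintype κ] [DecidableEq κ] {E : Type} [NormedAddCommGroup E] [NormedSpace ℂ E] [FiniteDimensional ℂ E]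
  {Ψ : (κ → ℝ) ≃L[ℝ] E} {η : E [⋀^Fin 2]→L[ℝ] ℝ}

/-- **Every complex torus isogenous to such a fivefold satisfies (D)** (no residual).
[cite: MoonenZarhin1999LowDim, Thm. (0.2) (4) (p0002 L1–L8)] [cite: Lange2023AbelianVarietiesComplex, §1.1.2 Cor. 1.1.16] -/
theorem IsIsogenous.forall_divisorClasses_powPeriod_eq_hodgeClasses_of_not_isSimple_of_finrank_eq_five_of_forall_not_isIsogenous_of_forall_isEmpty
    (hΦ : IsIsogenous Φ Ψ) (hη : IsRiemannForm Ψ η) (h5 : finrank ℂ E = 5) (hX : ¬ IsSimple Ψ)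
    (h4 : ∀ {κ' : Type} [Fintype κ'] [DecidableEq κ'] {E' : Type} [NormedAddCommGroup E'] [NormedSpace ℂ E']
      [FiniteDimensional ℂ E'] {Ψ' : (κ' → ℝ) ≃L[ℝ] E'} {η' : E' [⋀^Fin 2]→L[ℝ] ℝ}, IsRiemannForm Ψ' η' →
      finrank ℂ E' = 4 → IsSimple Ψ' → ∀ {τ : ℂ} (hτ : τ.im ≠ 0), ¬ IsIsogenous Ψ (prodPeriod Ψ' (ellipticPeriod hτ)))
    (hef : ∀ {κ' : Type} [Fintype κ'] [DecidableEq κ'] {E' : Type} [NormedAddCommGroup E'] [NormedSpace ℂ E']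
      [FiniteDimensional ℂ E'] {Ψ' : (κ' → ℝ) ≃L[ℝ] E'} {η' : E' [⋀^Fin 2]→L[ℝ] ℝ}, IsRiemannForm Ψ' η' →
      finrank ℂ E' = 3 → IsSimple Ψ' → ∀ {σ : ℂ} (hσ : σ.im ≠ 0) {ρ : ℂ} (hρ : ρ.im ≠ 0),
      IsIsogenous Ψ (prodPeriod (prodPeriod Ψ' (ellipticPeriod hσ)) (ellipticPeriod hρ)) → ellipticEnd hρ ≠ ⊥ →
      IsEmpty (Algebra.adjoin ℚ {ρ} →ₐ[ℚ] endAlgRat Ψ')) :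
    ∀ k p, divisorClasses (powPeriod Φ k) p = hodgeClasses (powPeriod Φ k) p :=
  hΦ.forall_powPeriod_divisorClasses_eq_hodgeClasses_iff.2
    (hη.forall_divisorClasses_powPeriod_eq_hodgeClasses_of_not_isSimple_of_finrank_eq_five_of_forall_not_isIsogenous_of_forall_isEmpty
      h5 hX h4 hef)

end FivefoldFinalIsogenous

end ComplexTorus

end Literature.Geometry.Kaehler
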